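import Literature.Computability.Cryptography.Postselection
import Literature.Computability.QuantumComplexity.RevMultiplex
import Literature.Computability.QuantumComplexity.RevTableau
import Literature.Computability.QuantumComplexity.WireConjugation
import Literature.Computability.QuantumComplexity.CWrapUniform
import HarnessLib

/-!
# Post-BQP error reduction by parallel repetition (the amplified family)

Topic `Literature/Computability/QuantumComplexity`; the construction behind the discharge of the
named fact `PostBQP_subset_PostBQPWith` of `PostBQPToPostIQP.lean` (post-BQP does not depend on
the error tolerance: Bremner–Jozsa–Shepherd, Proc. R. Soc. A 467 (2011), §2.4 p. 6, after Def. 3: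
"the standard method for reducing `ε` is to consider the majority vote answer of multiple runs of
the circuit. Similarly post-BPP and post-BQP are easily seen to be independent of the error
tolerance value too"; Aaronson 2005, §2), proved in `PostBQPToPostIQPProofs.lean` from the
summary theorem `PostBQPAmp.exists_amplified` of this file.

Given an oracle-free, polynomial-time uniform Clifford+T family `F` (tree model of
`Cryptography/QuantumCircuit.lean`, post-selection conventions of `Cryptography/Postselection.lean`:
output wire `0`, post-selection wire `1`, value `1`) and `K ≥ 1`, the **amplified family** runs
`K` copies of `F.circ n` on pairwise disjoint blocks of wires, the input `x` being fanned out to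
every block, and post-selects on the event "every copy post-selects **and the copies are
unanimous**" (all accept or all reject), answering the common verdict. Its post-selection weight
is `a^K + r^K` and its joint acceptance weight `a^K`, for the weights `a = Pr[out = 1 ∧ post = 1]`,
`r = Pr[out = 0 ∧ post = 1]` of one copy (`postselectProbOn_family`, `jointAcceptProbOn_family`),
so the conditional acceptance probability `a^K/(a^K + r^K)` is `≥ 2^K/(2^K + 1)` resp.
`≤ 1/(2^K + 1)` under the thresholds `a ≥ 2r` resp. `r ≥ 2a` — the unanimity variant of the
printed majority vote, which needs no Chernoff bound; the single post-selection line is the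
reversibly computed `OR` (here: `XOR` of disjoint events) of the two unanimity events, as in BJS
§2.4: "for any register of `k` lines we may adjoin a circuit that computes some simple function".

## Contents

* **Part I — layout and classical programs.** All sizes are explicit polynomial expressions in
  `n` (block width `b n = n + pF n + 2` for a polynomial bound `pF` of the ancilla count of `F`,
  `QCircuitFamily.IsUniform.isPolySize'`); the reversible programs over `ℕ`-indexed wires
  (`RevGadgets.ClOp`): `prog1` (fan-out of the input, `CNOT`s), `progConj n j` (swap of the front
  window `[0, b n)` with block `j`, `RevMux.swapOps`), `prog2` (constant-`1` seed, three Toffoli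
  chains `clChain` computing "all copies post-select", "… and all accept" `A`, "… and all reject"
  `R`, the `CNOT` `aR ← R ⊕ A`, the swaps `A ↦ 0`, `R ⊕ A ↦ 1`); well-formedness, wire bounds and
  classical semantics (`clEval_prog1_blk`, `clEval_prog2_zero`, `clEval_prog2_one`).
* **Part II — circuits and matrices.** `clamp` (re-indexing to `Fin (n + anc n)`, `toRevList`),
  `stage1`/`stage2` (`revCompile`), `conjGates`, `copyGates` (`F.circ n` on the front wires,
  verbatim), `stageQ`, `circ`, `family`; oracle-freeness; stage 1 on `|x 0…0⟩` (`W1`); the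
  conjugating swap as a wire involution (`conjInvol`, `WireConjugation.toMatrix_conj_mapWires`),
  the quantum stage as the product of the padded copies `Cpad` on the blocks `blockEmb`
  (`toMatrix_stageQ`) and the product state after it (`stageQ_mulVec_W1`, `CircuitEmbedding`);
  stage 2 as a basis permutation `perm2`; `runOn_circ`.
* **Part III — weights.** `accW`/`rejW` (`accW_eq`, `accW_add_rejW`), the block events `accB`/`rejB`
  and their weights (`sum_normSq_placeGate_castLE`), product weights (`Finset.sum_pow'`), the
  measured events pulled back along `perm2` (`sum_ite_normSq_mulVec_of_perm`), and the two
  probability formulas.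
* **Part IV — uniformity.** Stage descriptions are program descriptions
  (`RevDesc.flatMap_gateEnc_revCompile_toRevList`, the copy verbatim); the layout as counter
  expressions (`CWrap.polyE`); generator programs (`gen1`: two nested loops; `RevMuxGen.swapsG`;
  `opsG prog2E`) rendered by `GStmt.render_out_mem_FP`; `family_isUniform`
  (`QCircuitFamily.isUniform_of_descFn_mem_FP`). Summary: `exists_amplified`.

Not here: the real-number threshold estimates and the discharge itself
(`PostBQPToPostIQPProofs.lean`); unitarity is never used (all weights are plain Born sums).

## References

* M. J. Bremner, R. Jozsa, D. J. Shepherd, *Classical simulation of commuting quantum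
  computations implies collapse of the polynomial hierarchy*, Proc. R. Soc. A 467 (2011)
  459–472, arXiv:1005.1407: Def. 3, §2.4 p. 6 [BremnerJozsaShepherdPRSA2011].
* S. Aaronson, *Quantum computing, postselection, and probabilistic polynomial-time*,
  Proc. R. Soc. A 461 (2005), Def. 1, §2 [Aaronson2005].
* M. A. Nielsen, I. L. Chuang, *Quantum Computation and Quantum Information*, CUP 2010, §1.3.4
  (swap from three `CNOT`s), §2.1.7 eq. (2.45), §2.2.8, §3.2.5 (Toffoli chains with ancillas),
  §4.3 [NielsenChuang2010].
* S. Arora, B. Barak, *Computational Complexity: A Modern Approach*, CUP 2009, §6.1–6.2,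
  Def. 6.12, Remark 6.7, proof of Thm. 6.15; §10.3.7 Lemma 10.10 [AroraBarak2009].
-/

noncomputable section

namespace Literature.Computability.QuantumComplexity

namespace PostBQPAmp

open _root_.Computability Complexity Cryptography RevSim RevMux Function Matrix

/-! ## Part I. Layout and the classical programs -/

/-! ### Parameters -/

/-- The data of the amplified family (a hypothesis structure): the given family `F`, a
polynomial bound `pF` of its ancilla count, and the number `K ≥ 1` of copies. [folklore] -/
structure Params where
  /-- the given family -/
  F : QCircuitFamily cliffordT
  /-- a polynomial bound of its ancilla count -/
  pF : Polynomial ℕ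
  /-- the bound -/
  hpF : ∀ n, F.ancillas n ≤ pF.eval n
  /-- the number of copies -/
  K : ℕ
  /-- there is a copy -/
  hK : 0 < K

variable (P : Params)

/-! ### Layout -/

/-- The block width (= the width of the front window): `n + pF n + 2`. [folklore] -/
def b (n : ℕ) : ℕ := n + P.pF.eval n + 2

/-- The constant-`1` seed wire. [folklore] -/
def oneW (n : ℕ) : ℕ := b P n

/-- Ancilla `t` of the chain "all copies post-select". [folklore] -/
def cP (n t : ℕ) : ℕ := b P n + 1 + t

/-- Ancilla `t` of the chain "… and all accept". [folklore] -/
def cA (n t : ℕ) : ℕ := b P n + 1 + P.K + t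

/-- Ancilla `t` of the chain "… and all reject". [folklore] -/
def cR (n t : ℕ) : ℕ := b P n + 1 + 2 * P.K + t

/-- The last ancilla of the chain "all copies post-select". [folklore] -/
def aP (n : ℕ) : ℕ := cP P n (P.K - 1)

/-- The last ancilla of the chain "… and all accept" (the value `A`). [folklore] -/
def aA (n : ℕ) : ℕ := cA P n (P.K - 1)

/-- The last ancilla of the chain "… and all reject" (the value `R`, later `A ⊕ R`). [folklore] -/
def aR (n : ℕ) : ℕ := cR P n (P.K - 1)

/-- The first wire of the blocks. [folklore] -/
def base (n : ℕ) : ℕ := b P n + 1 + 3 * P.K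

/-- Wire `i` of block `j`. [folklore] -/
def blk (n j i : ℕ) : ℕ := base P n + j * b P n + i

/-- The total number of wires. [folklore] -/
def W (n : ℕ) : ℕ := base P n + P.K * b P n

/-- The number of ancillas. [folklore] -/
def anc (n : ℕ) : ℕ := W P n - n

/-! ### Size bookkeeping -/

section Sizes

variable {P}

/-- `2 ≤ b n`. [folklore] -/
theorem two_le_b (n : ℕ) : 2 ≤ b P n := by unfold b; omega

/-- `n + 2 ≤ b n`. [folklore] -/
theorem add_two_le_b (n : ℕ) : n + 2 ≤ b P n := by unfold b; omega

/-- The copy fits into a block: `n + F.ancillas n ≤ b n`. [folklore] -/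
theorem copy_fits (n : ℕ) : n + P.F.ancillas n ≤ b P n := by
  have := P.hpF n; unfold b; omega

/-- `b n < base n` (indeed `oneW`, the chain ancillas lie in `[b n, base n)`). [folklore] -/
theorem b_lt_base (n : ℕ) : b P n < base P n := by unfold base; omega

/-- `base n ≤ W n`. [folklore] -/
theorem base_le_W (n : ℕ) : base P n ≤ W P n := by unfold W; exact Nat.le_add_right _ _

/-- `blk n 0 0 = base n`. [folklore] -/
theorem blk_zero_zero (n : ℕ) : blk P n 0 0 = base P n := by unfold blk; simp

/-- `blk n j i = blk n j 0 + i`. [folklore] -/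
theorem blk_eq_add (n j i : ℕ) : blk P n j i = blk P n j 0 + i := by unfold blk; omega

/-- Wires of block `j < K` are below `W`. [folklore] -/
theorem blk_lt_W {n j i : ℕ} (hj : j < P.K) (hi : i < b P n) : blk P n j i < W P n := by
  unfold blk W
  have : j * b P n + i < P.K * b P n := by
    calc j * b P n + i < j * b P n + b P n := by omega
      _ = (j + 1) * b P n := by ring
      _ ≤ P.K * b P n := Nat.mul_le_mul_right _ hj
  omega

/-- The end of block `K - 1` is `W`. [folklore] -/
theorem blk_K (n : ℕ) : blk P n P.K 0 = W P n := by unfold blk W; ring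

/-- Blocks are disjoint: equal wires have equal block and offset. [folklore] -/
theorem blk_inj {n j i j' i' : ℕ} (hi : i < b P n) (hi' : i' < b P n) (h : blk P n j i = blk P n j' i') :
    j = j' ∧ i = i' := by
  unfold blk at h
  have h1 : j * b P n + i = j' * b P n + i' := by omega
  have hj : j = j' := by nlinarith
  subst hj
  exact ⟨rfl, by omega⟩

/-- `base ≤ blk`. [folklore] -/
theorem base_le_blk (n j i : ℕ) : base P n ≤ blk P n j i := by unfold blk; omega

/-- `n ≤ W n`. [folklore] -/
theorem le_W (n : ℕ) : n ≤ W P n :=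
  ((Nat.le_add_right n 2).trans (add_two_le_b n)).trans ((b_lt_base n).le.trans (base_le_W n))

/-- **`n + anc n = W n`.** [folklore] -/
theorem n_add_anc (n : ℕ) : n + anc P n = W P n := by have := le_W (P := P) n; unfold anc; omega

/-- There is a wire. [folklore] -/
theorem width_pos (n : ℕ) : 0 < n + anc P n := by
  rw [n_add_anc]; exact lt_of_lt_of_le (lt_of_lt_of_le (by norm_num) (two_le_b n)) ((b_lt_base n).le.trans (base_le_W n))

/-- `oneW < base`. [folklore] -/
theorem oneW_lt_base (n : ℕ) : oneW P n < base P n := by unfold oneW base; omega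

/-- `cP t < base` for `t < K`. [folklore] -/
theorem cP_lt_base {n t : ℕ} (ht : t < P.K) : cP P n t < base P n := by unfold cP base; omega

/-- `cA t < base` for `t < K`. [folklore] -/
theorem cA_lt_base {n t : ℕ} (ht : t < P.K) : cA P n t < base P n := by unfold cA base; omega

/-- `cR t < base` for `t < K`. [folklore] -/
theorem cR_lt_base {n t : ℕ} (ht : t < P.K) : cR P n t < base P n := by unfold cR base; omega

/-- `b ≤ oneW`. [folklore] -/
theorem b_le_oneW (n : ℕ) : b P n ≤ oneW P n := le_rfl

/-- `b < cP t`. [folklore] -/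
theorem b_lt_cP (n t : ℕ) : b P n < cP P n t := by unfold cP; omega

/-- `b < cA t`. [folklore] -/
theorem b_lt_cA (n t : ℕ) : b P n < cA P n t := by unfold cA; omega

/-- `b < cR t`. [folklore] -/
theorem b_lt_cR (n t : ℕ) : b P n < cR P n t := by unfold cR; omega

/-- `aP < base`. [folklore] -/
theorem aP_lt_base (n : ℕ) : aP P n < base P n := cP_lt_base (Nat.sub_lt P.hK Nat.one_pos)

/-- `aA < base`. [folklore] -/
theorem aA_lt_base (n : ℕ) : aA P n < base P n := cA_lt_base (Nat.sub_lt P.hK Nat.one_pos)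

/-- `aR < base`. [folklore] -/
theorem aR_lt_base (n : ℕ) : aR P n < base P n := cR_lt_base (Nat.sub_lt P.hK Nat.one_pos)

/-- `2 ≤ aA`. [folklore] -/
theorem two_lt_aA (n : ℕ) : 2 < aA P n := by have := two_le_b (P := P) n; unfold aA cA; omega

/-- `2 ≤ aR`. [folklore] -/
theorem two_lt_aR (n : ℕ) : 2 < aR P n := by have := two_le_b (P := P) n; unfold aR cR; omega

/-- `aA ≠ aR`. [folklore] -/
theorem aA_ne_aR (n : ℕ) : aA P n ≠ aR P n := by have := P.hK; unfold aA aR cA cR; omega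

/-- `aP ≠ aA`. [folklore] -/
theorem aP_ne_aA (n : ℕ) : aP P n ≠ aA P n := by have := P.hK; unfold aP aA cP cA; omega

/-- `aP ≠ aR`. [folklore] -/
theorem aP_ne_aR (n : ℕ) : aP P n ≠ aR P n := by have := P.hK; unfold aP aR cP cR; omega

/-- `base < W` (there is a block). [folklore] -/
theorem base_lt_W (n : ℕ) : base P n < W P n := by
  have h := blk_lt_W (P := P) (n := n) (j := 0) (i := 0) P.hK (lt_of_lt_of_le Nat.zero_lt_two (two_le_b n))
  rwa [blk_zero_zero] at h

end Sizes

/-! ### The programs -/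

/-- **Stage 1: fan-out of the input** into the input wires of every block. [cite: NielsenChuang2010, §1.3.4 (CNOT copies classical bits)] -/
def prog1 (n : ℕ) : List (ClOp ℕ) :=
  (List.range P.K).flatMap fun j => (List.range n).map fun i => ClOp.cnot i (blk P n j i)

/-- The pairs (front wire `i`, wire `i` of block `j`), `i < b n`. [folklore] -/
def conjPairs (n j : ℕ) : List (ℕ × ℕ) := (List.range (b P n)).map fun i => (i, blk P n j i)

/-- **The conjugating swap of block `j` with the front window.** [cite: NielsenChuang2010, §1.3.4 (swap from three CNOTs)] -/
def progConj (n j : ℕ) : List (ClOp ℕ) := swapOps (conjPairs P n j)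

/-- The post-selection wires of the blocks (wire `1` of each copy). [folklore] -/
def posts (n : ℕ) : List ℕ := (List.range P.K).map fun j => blk P n j 1

/-- The output wires of the blocks (wire `0` of each copy). [folklore] -/
def outs (n : ℕ) : List ℕ := (List.range P.K).map fun j => blk P n j 0

/-- The ancillas of the chain "all copies post-select". [folklore] -/
def cPs (n : ℕ) : List ℕ := (List.range P.K).map (cP P n)

/-- The ancillas of the chain "… and all accept". [folklore] -/
def cAs (n : ℕ) : List ℕ := (List.range P.K).map (cA P n)

/-- The ancillas of the chain "… and all reject". [folklore] -/
def cRs (n : ℕ) : List ℕ := (List.range P.K).map (cR P n)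

/-- **Stage 2: the unanimity gadget.** Seed `1`; `aP ← ⋀ⱼ postⱼ`; `aA ← aP ∧ ⋀ⱼ outⱼ`; negate
the outputs; `aR ← aP ∧ ⋀ⱼ ¬outⱼ`; `aR ← aR ⊕ aA`; swap `aA ↦ 0`, `aR ↦ 1`. [cite: NielsenChuang2010, §3.2.5 (Toffoli chains with ancillas)] -/
def prog2 (n : ℕ) : List (ClOp ℕ) :=
  [ClOp.not (oneW P n)] ++ clChain (oneW P n) (posts P n) (cPs P n) ++ clChain (aP P n) (outs P n) (cAs P n) ++
    (outs P n).map ClOp.not ++ clChain (aP P n) (outs P n) (cRs P n) ++ [ClOp.cnot (aA P n) (aR P n)] ++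
      swapOps [(aA P n, 0), (aR P n, 1)]

/-! ### Well-formedness -/

section WF

variable {P}

/-- Membership in `prog1`. [folklore] -/
theorem mem_prog1 {n : ℕ} {op : ClOp ℕ} : op ∈ prog1 P n ↔ ∃ j < P.K, ∃ i < n, op = ClOp.cnot i (blk P n j i) := by
  simp only [prog1, List.mem_flatMap, List.mem_range, List.mem_map]
  constructor
  · rintro ⟨j, hj, i, hi, rfl⟩; exact ⟨j, hj, i, hi, rfl⟩
  · rintro ⟨j, hj, i, hi, rfl⟩; exact ⟨j, hj, i, hi, rfl⟩

/-- `prog1` is well formed. [folklore] -/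
theorem prog1_wf (n : ℕ) : ∀ op ∈ prog1 P n, op.WF := by
  intro op hop
  obtain ⟨j, -, i, hi, rfl⟩ := mem_prog1.1 hop
  have : i < base P n := lt_of_lt_of_le hi ((Nat.le_add_right n 2).trans ((add_two_le_b n).trans (b_lt_base n).le))
  exact Nat.ne_of_lt (lt_of_lt_of_le this (base_le_blk n j i))

/-- `progConj` is well formed. [folklore] -/
theorem progConj_wf (n j : ℕ) : ∀ op ∈ progConj P n j, op.WF := by
  refine swapOps_wf fun p hp => ?_
  simp only [conjPairs, List.mem_map, List.mem_range] at hp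
  obtain ⟨i, hi, rfl⟩ := hp
  exact Nat.ne_of_lt (lt_of_lt_of_le hi ((b_lt_base n).le.trans (base_le_blk n j i)))

/-- The chain ancillas are pairwise distinct: `cPs`. [folklore] -/
theorem nodup_cPs (n : ℕ) : (cPs P n).Nodup := List.nodup_range.map_on fun a _ b _ h => by unfold cP at h; omega

/-- The chain ancillas are pairwise distinct: `cAs`. [folklore] -/
theorem nodup_cAs (n : ℕ) : (cAs P n).Nodup := List.nodup_range.map_on fun a _ b _ h => by unfold cA at h; omega

/-- The chain ancillas are pairwise distinct: `cRs`. [folklore] -/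
theorem nodup_cRs (n : ℕ) : (cRs P n).Nodup := List.nodup_range.map_on fun a _ b _ h => by unfold cR at h; omega

/-- The output wires are pairwise distinct. [folklore] -/
theorem nodup_outs (n : ℕ) : (outs P n).Nodup :=
  List.nodup_range.map_on fun a _ b _ h => (blk_inj (lt_of_lt_of_le (by norm_num) (two_le_b n)) (lt_of_lt_of_le (by norm_num) (two_le_b n)) h).1

/-- Membership in `cPs`. [folklore] -/
theorem mem_cPs {n p : ℕ} : p ∈ cPs P n ↔ ∃ t < P.K, cP P n t = p := by simp [cPs]

/-- Membership in `cAs`. [folklore] -/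
theorem mem_cAs {n p : ℕ} : p ∈ cAs P n ↔ ∃ t < P.K, cA P n t = p := by simp [cAs]

/-- Membership in `cRs`. [folklore] -/
theorem mem_cRs {n p : ℕ} : p ∈ cRs P n ↔ ∃ t < P.K, cR P n t = p := by simp [cRs]

/-- Membership in `posts`. [folklore] -/
theorem mem_posts {n p : ℕ} : p ∈ posts P n ↔ ∃ j < P.K, blk P n j 1 = p := by simp [posts]

/-- Membership in `outs`. [folklore] -/
theorem mem_outs {n p : ℕ} : p ∈ outs P n ↔ ∃ j < P.K, blk P n j 0 = p := by simp [outs]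

/-- A wire below `base` is not a block wire listed in `posts`. [folklore] -/
theorem not_mem_posts_of_lt {n p : ℕ} (hp : p < base P n) : p ∉ posts P n := fun h => by
  obtain ⟨j, -, rfl⟩ := mem_posts.1 h; exact absurd (base_le_blk (P := P) n j 1) (Nat.not_le.2 hp)

/-- A wire below `base` is not a block wire listed in `outs`. [folklore] -/
theorem not_mem_outs_of_lt {n p : ℕ} (hp : p < base P n) : p ∉ outs P n := fun h => by
  obtain ⟨j, -, rfl⟩ := mem_outs.1 h; exact absurd (base_le_blk (P := P) n j 0) (Nat.not_le.2 hp)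

/-- Block wires are not in `cPs`. [folklore] -/
theorem blk_not_mem_cPs (n j i : ℕ) : blk P n j i ∉ cPs P n := fun h => by
  obtain ⟨t, ht, e⟩ := mem_cPs.1 h; exact absurd (base_le_blk (P := P) n j i) (by rw [← e]; exact Nat.not_le.2 (cP_lt_base ht))

/-- Block wires are not in `cAs`. [folklore] -/
theorem blk_not_mem_cAs (n j i : ℕ) : blk P n j i ∉ cAs P n := fun h => by
  obtain ⟨t, ht, e⟩ := mem_cAs.1 h; exact absurd (base_le_blk (P := P) n j i) (by rw [← e]; exact Nat.not_le.2 (cA_lt_base ht))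

/-- Block wires are not in `cRs`. [folklore] -/
theorem blk_not_mem_cRs (n j i : ℕ) : blk P n j i ∉ cRs P n := fun h => by
  obtain ⟨t, ht, e⟩ := mem_cRs.1 h; exact absurd (base_le_blk (P := P) n j i) (by rw [← e]; exact Nat.not_le.2 (cR_lt_base ht))

/-- `oneW ∉ cPs`. [folklore] -/
theorem oneW_not_mem_cPs (n : ℕ) : oneW P n ∉ cPs P n := fun h => by
  obtain ⟨t, -, e⟩ := mem_cPs.1 h; unfold cP oneW at e; omega

/-- `aP ∉ cAs`. [folklore] -/
theorem aP_not_mem_cAs (n : ℕ) : aP P n ∉ cAs P n := fun h => by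
  obtain ⟨t, -, e⟩ := mem_cAs.1 h; have := P.hK; unfold cA aP cP at e; omega

/-- `aP ∉ cRs`. [folklore] -/
theorem aP_not_mem_cRs (n : ℕ) : aP P n ∉ cRs P n := fun h => by
  obtain ⟨t, -, e⟩ := mem_cRs.1 h; have := P.hK; unfold cR aP cP at e; omega

/-- `aA ∉ cRs`. [folklore] -/
theorem aA_not_mem_cRs (n : ℕ) : aA P n ∉ cRs P n := fun h => by
  obtain ⟨t, -, e⟩ := mem_cRs.1 h; have := P.hK; unfold cR aA cA at e; omega

/-- `aP ∈ cPs` is its last element. [folklore] -/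
theorem cPs_ne_nil (n : ℕ) : cPs P n ≠ [] := by
  have := P.hK; simp [cPs, List.range_eq_nil]; omega

/-- `cAs` is nonempty. [folklore] -/
theorem cAs_ne_nil (n : ℕ) : cAs P n ≠ [] := by
  have := P.hK; simp [cAs, List.range_eq_nil]; omega

/-- `cRs` is nonempty. [folklore] -/
theorem cRs_ne_nil (n : ℕ) : cRs P n ≠ [] := by
  have := P.hK; simp [cRs, List.range_eq_nil]; omega

/-- The last element of a mapped range. [folklore] -/
theorem getLast_map_range {f : ℕ → ℕ} {k : ℕ} (h : (List.range k).map f ≠ []) :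
    ((List.range k).map f).getLast h = f (k - 1) := by
  cases k with
  | zero => simp at h
  | succ k => simp [List.range_succ]

/-- The last of `cPs` is `aP`. [folklore] -/
theorem getLast_cPs (n : ℕ) : (cPs P n).getLast (cPs_ne_nil n) = aP P n := getLast_map_range _

/-- The last of `cAs` is `aA`. [folklore] -/
theorem getLast_cAs (n : ℕ) : (cAs P n).getLast (cAs_ne_nil n) = aA P n := getLast_map_range _

/-- The last of `cRs` is `aR`. [folklore] -/
theorem getLast_cRs (n : ℕ) : (cRs P n).getLast (cRs_ne_nil n) = aR P n := getLast_map_range _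

/-- `prog2` is well formed. [folklore] -/
theorem prog2_wf (n : ℕ) : ∀ op ∈ prog2 P n, op.WF := by
  intro op hop
  simp only [prog2, List.mem_append, List.mem_singleton] at hop
  rcases hop with (((((rfl | hop) | hop) | hop) | hop) | rfl) | hop
  · trivial
  · refine wf_of_mem_clChain (nodup_cPs n) (oneW_not_mem_cPs n) (fun l hl => ?_) hop
    obtain ⟨j, -, rfl⟩ := mem_posts.1 hl
    exact ⟨blk_not_mem_cPs n j 1, Nat.ne_of_gt (lt_of_lt_of_le (oneW_lt_base n) (base_le_blk n j 1))⟩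
  · refine wf_of_mem_clChain (nodup_cAs n) (aP_not_mem_cAs n) (fun l hl => ?_) hop
    obtain ⟨j, -, rfl⟩ := mem_outs.1 hl
    exact ⟨blk_not_mem_cAs n j 0, Nat.ne_of_gt (lt_of_lt_of_le (aP_lt_base n) (base_le_blk n j 0))⟩
  · obtain ⟨a, -, rfl⟩ := List.mem_map.1 hop; trivial
  · refine wf_of_mem_clChain (nodup_cRs n) (aP_not_mem_cRs n) (fun l hl => ?_) hop
    obtain ⟨j, -, rfl⟩ := mem_outs.1 hl
    exact ⟨blk_not_mem_cRs n j 0, Nat.ne_of_gt (lt_of_lt_of_le (aP_lt_base n) (base_le_blk n j 0))⟩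
  · exact aA_ne_aR n
  · refine swapOps_wf (fun p hp => ?_) op hop
    simp only [List.mem_cons, List.not_mem_nil, or_false] at hp
    rcases hp with rfl | rfl
    · exact Nat.ne_of_gt (lt_trans (by norm_num) (two_lt_aA n))
    · exact Nat.ne_of_gt (lt_trans (by norm_num) (two_lt_aR n))

end WF

/-! ### Wire bounds -/

section Bounds

variable {P}

/-- `prog1` uses wires below `W`. [folklore] -/
theorem prog1_lt (n : ℕ) : ∀ op ∈ prog1 P n, ∀ p ∈ wiresOf op, p < W P n := by
  intro op hop p hp
  obtain ⟨j, hj, i, hi, rfl⟩ := mem_prog1.1 hop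
  simp only [mem_wiresOf, ClOp.target, ClOp.controls, List.mem_singleton] at hp
  rcases hp with rfl | rfl
  · exact blk_lt_W hj (lt_of_lt_of_le hi ((Nat.le_add_right n 2).trans (add_two_le_b n)))
  · exact lt_of_lt_of_le hi (le_W n)

/-- `progConj n j`, `j < K`, uses wires below `W`. [folklore] -/
theorem progConj_lt {n j : ℕ} (hj : j < P.K) : ∀ op ∈ progConj P n j, ∀ p ∈ wiresOf op, p < W P n := by
  intro op hop p hp
  obtain ⟨q, hq, h⟩ := CWrap.wiresOf_swapOps hop p hp
  simp only [conjPairs, List.mem_map, List.mem_range] at hq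
  obtain ⟨i, hi, rfl⟩ := hq
  rcases h with rfl | rfl
  · exact lt_of_lt_of_le hi ((b_lt_base n).le.trans (base_le_W n))
  · exact blk_lt_W hj hi

/-- Wires of the chains are below `W`. [folklore] -/
theorem wiresOf_clChain_lt {n a₀ : ℕ} {ls as : List ℕ} (h0 : a₀ < W P n) (hls : ∀ l ∈ ls, l < W P n)
    (has : ∀ a ∈ as, a < W P n) : ∀ op ∈ clChain a₀ ls as, ∀ p ∈ wiresOf op, p < W P n := by
  induction ls generalizing a₀ as with
  | nil => simp
  | cons l ls ih =>
    cases as with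
    | nil => simp
    | cons a as =>
      intro op hop p hp
      rw [clChain_cons_cons, List.mem_cons] at hop
      rcases hop with rfl | hop
      · simp only [mem_wiresOf, ClOp.target, ClOp.controls, List.mem_cons, List.not_mem_nil, or_false] at hp
        rcases hp with rfl | rfl | rfl
        · exact has _ (by simp)
        · exact h0
        · exact hls _ (by simp)
      · exact ih (has a (by simp)) (fun l' hl' => hls l' (by simp [hl'])) (fun a' ha' => has a' (by simp [ha'])) op hop p hp

/-- Post-selection wires are below `W`. [folklore] -/
theorem posts_lt {n p : ℕ} (hp : p ∈ posts P n) : p < W P n := by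
  obtain ⟨j, hj, rfl⟩ := mem_posts.1 hp; exact blk_lt_W hj (two_le_b n)

/-- Output wires are below `W`. [folklore] -/
theorem outs_lt {n p : ℕ} (hp : p ∈ outs P n) : p < W P n := by
  obtain ⟨j, hj, rfl⟩ := mem_outs.1 hp; exact blk_lt_W hj (lt_of_lt_of_le (by norm_num) (two_le_b n))

/-- `prog2` uses wires below `W`. [folklore] -/
theorem prog2_lt (n : ℕ) : ∀ op ∈ prog2 P n, ∀ p ∈ wiresOf op, p < W P n := by
  have hbW : base P n ≤ W P n := base_le_W n
  intro op hop p hp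
  simp only [prog2, List.mem_append, List.mem_singleton] at hop
  rcases hop with (((((rfl | hop) | hop) | hop) | hop) | rfl) | hop
  · simp only [mem_wiresOf, ClOp.target, ClOp.controls, List.not_mem_nil, or_false] at hp
    subst hp; exact lt_of_lt_of_le (oneW_lt_base n) hbW
  · exact wiresOf_clChain_lt (lt_of_lt_of_le (oneW_lt_base n) hbW) (fun l hl => posts_lt hl)
      (fun a ha => by obtain ⟨t, ht, rfl⟩ := mem_cPs.1 ha; exact lt_of_lt_of_le (cP_lt_base ht) hbW) op hop p hp
  · exact wiresOf_clChain_lt (lt_of_lt_of_le (aP_lt_base n) hbW) (fun l hl => outs_lt hl)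
      (fun a ha => by obtain ⟨t, ht, rfl⟩ := mem_cAs.1 ha; exact lt_of_lt_of_le (cA_lt_base ht) hbW) op hop p hp
  · obtain ⟨a, ha, rfl⟩ := List.mem_map.1 hop
    simp only [mem_wiresOf, ClOp.target, ClOp.controls, List.not_mem_nil, or_false] at hp
    subst hp; exact outs_lt ha
  · exact wiresOf_clChain_lt (lt_of_lt_of_le (aP_lt_base n) hbW) (fun l hl => outs_lt hl)
      (fun a ha => by obtain ⟨t, ht, rfl⟩ := mem_cRs.1 ha; exact lt_of_lt_of_le (cR_lt_base ht) hbW) op hop p hp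
  · simp only [mem_wiresOf, ClOp.target, ClOp.controls, List.mem_singleton] at hp
    rcases hp with rfl | rfl
    · exact lt_of_lt_of_le (aR_lt_base n) hbW
    · exact lt_of_lt_of_le (aA_lt_base n) hbW
  · obtain ⟨q, hq, h⟩ := CWrap.wiresOf_swapOps hop p hp
    simp only [List.mem_cons, List.not_mem_nil, or_false] at hq
    have h2 : 2 < W P n := lt_of_lt_of_le (two_lt_aA n) ((aA_lt_base n).le.trans hbW)
    rcases hq with rfl | rfl <;> rcases h with rfl | rfl
    · exact lt_of_lt_of_le (aA_lt_base n) hbW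
    · exact lt_trans (by norm_num) h2
    · exact lt_of_lt_of_le (aR_lt_base n) hbW
    · exact lt_trans (by norm_num) h2

end Bounds

/-! ### Semantics of stage 1 -/

section Stage1

/-- The padded input, extended to `ℕ` by zeros: the string `x` followed by zeros. [folklore] -/
def inp (x : List Bool) : ℕ → Bool := fun p => x.getD p false

/-- **The assignment after stage 1** on the input `x`. [folklore] -/
def w1 (x : List Bool) : ℕ → Bool := clEval (prog1 P x.length) (inp x)

variable {P}

/-- Targets of `prog1` are never controls of `prog1`. [folklore] -/
theorem prog1_disjoint (n : ℕ) : ∀ op ∈ prog1 P n, ∀ op' ∈ prog1 P n, op'.target ∉ op.controls := by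
  intro op hop op' hop'
  obtain ⟨j, -, i, hi, rfl⟩ := mem_prog1.1 hop
  obtain ⟨j', -, i', -, rfl⟩ := mem_prog1.1 hop'
  simp only [ClOp.target, ClOp.controls, List.mem_singleton]
  intro h
  have h1 := base_le_blk (P := P) n j' i'
  have h2 : i < base P n := lt_of_lt_of_le hi ((Nat.le_add_right n 2).trans ((add_two_le_b n).trans (b_lt_base n).le))
  omega

/-- `prog1` does not touch wires that are not block input wires. [folklore] -/
theorem clEval_prog1_of_ne (n : ℕ) (w : ℕ → Bool) {p : ℕ} (hp : ∀ j < P.K, ∀ i < n, p ≠ blk P n j i) :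
    clEval (prog1 P n) w p = w p :=
  clEval_apply_of_forall_target_ne _ _ fun op hop e => by
    obtain ⟨j, hj, i, hi, rfl⟩ := mem_prog1.1 hop
    exact hp j hj i hi e.symm

/-- `prog1` does not touch wires below `base`. [folklore] -/
theorem clEval_prog1_of_lt_base (n : ℕ) (w : ℕ → Bool) {p : ℕ} (hp : p < base P n) : clEval (prog1 P n) w p = w p :=
  clEval_prog1_of_ne n w fun j _ i _ e => absurd (base_le_blk (P := P) n j i) (by rw [← e]; exact Nat.not_le.2 hp)

/-- **`prog1` XORs input wire `i` into wire `i` of every block.** [cite: NielsenChuang2010, §1.3.4 (CNOT copies classical bits)] -/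
theorem clEval_prog1_blk (n : ℕ) (w : ℕ → Bool) {j i : ℕ} (hj : j < P.K) (hi : i < n) :
    clEval (prog1 P n) w (blk P n j i) = (w (blk P n j i) ^^ w i) := by
  have hib : ∀ i, i < n → i < b P n := fun i hi => lt_of_lt_of_le hi ((Nat.le_add_right n 2).trans (add_two_le_b n))
  rw [clEval_apply_of_disjoint _ (prog1_disjoint n)]
  congr 1
  unfold prog1
  rw [clToggle_flatMap_of_forall_ne (List.range P.K) _ w (blk P n j i) j List.nodup_range (List.mem_range.2 hj) ?_]
  · have hmem : ClOp.cnot i (blk P n j i) ∈ (List.range n).map fun i => ClOp.cnot i (blk P n j i) :=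
      List.mem_map.2 ⟨i, List.mem_range.2 hi, rfl⟩
    have h := clToggle_eq_guard_of_nodup ((List.range n).map fun i => ClOp.cnot i (blk P n j i)) w ?_ hmem
    · simpa [ClOp.target, ClOp.guard] using h
    · rw [List.map_map]
      exact List.nodup_range.map_on fun a _ c _ h => by
        simp only [Function.comp_apply, ClOp.target] at h
        unfold blk at h; omega
  · intro j' _ hne op hop
    obtain ⟨i', hi', rfl⟩ := List.mem_map.1 hop
    simp only [ClOp.target]
    intro e
    exact hne (blk_inj (hib i' (List.mem_range.1 hi')) (hib i hi) e).1

/-- `inp x` vanishes from `|x|` on. [folklore] -/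
theorem inp_of_le (x : List Bool) {p : ℕ} (hp : x.length ≤ p) : inp x p = false := by
  unfold inp; rw [List.getD_eq_getElem?_getD, List.getElem?_eq_none hp]; rfl

/-- The padded input, lifted to `ℕ`, is `inp x`. [folklore] -/
theorem liftW_padInput_get (x : List Bool) (m : ℕ) : liftW (padInput x.get m) = inp x := by
  funext i
  unfold liftW inp padInput
  by_cases hi : i < x.length + m
  · rw [dif_pos hi]
    by_cases hix : i < x.length
    · rw [show (⟨i, hi⟩ : Fin (x.length + m)) = Fin.castAdd m ⟨i, hix⟩ from rfl, Fin.append_left,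
        List.getD_eq_getElem?_getD, List.getElem?_eq_getElem hix]
      rfl
    · have him : i - x.length < m := by omega
      rw [show (⟨i, hi⟩ : Fin (x.length + m)) = Fin.natAdd x.length ⟨i - x.length, him⟩ from Fin.ext (by simp; omega),
        Fin.append_right, List.getD_eq_getElem?_getD, List.getElem?_eq_none (Nat.not_lt.1 hix)]
      rfl
  · rw [dif_neg hi, List.getD_eq_getElem?_getD, List.getElem?_eq_none (by omega)]
    rfl

/-- Below `base`, stage 1 keeps the input: `x` followed by zeros. [folklore] -/
theorem w1_of_lt_base (x : List Bool) {p : ℕ} (hp : p < base P x.length) : w1 P x p = inp x p :=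
  clEval_prog1_of_lt_base _ _ hp

/-- Data wires keep `x`. [folklore] -/
theorem w1_of_lt (x : List Bool) {p : ℕ} (hp : p < x.length) : w1 P x p = x.getD p false :=
  w1_of_lt_base x (lt_of_lt_of_le hp (((Nat.le_add_right _ 2).trans (add_two_le_b _)).trans (b_lt_base _).le))

/-- Wires in `[|x|, base)` are `0` after stage 1. [folklore] -/
theorem w1_of_le_of_lt_base (x : List Bool) {p : ℕ} (hp : x.length ≤ p) (hp' : p < base P x.length) : w1 P x p = false := by
  rw [w1_of_lt_base x hp']; exact inp_of_le x hp

/-- **The input wires of every block hold `x`.** [cite: NielsenChuang2010, §1.3.4 (CNOT copies classical bits)] -/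
theorem w1_blk_of_lt (x : List Bool) {j i : ℕ} (hj : j < P.K) (hi : i < x.length) : w1 P x (blk P x.length j i) = x.getD i false := by
  unfold w1
  rw [clEval_prog1_blk _ _ hj hi, inp_of_le x ((((Nat.le_add_right _ 2).trans (add_two_le_b _)).trans (b_lt_base _).le).trans
    (base_le_blk _ j i)), Bool.false_xor]
  rfl

/-- The other wires of every block are `0`. [folklore] -/
theorem w1_blk_of_le (x : List Bool) {j i : ℕ} (hi : x.length ≤ i) (hib : i < b P x.length) :
    w1 P x (blk P x.length j i) = false := by
  unfold w1
  rw [clEval_prog1_of_ne _ _ (fun j' _ i' hi' e => ?_)]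
  · exact inp_of_le x ((((Nat.le_add_right _ 2).trans (add_two_le_b _)).trans (b_lt_base _).le).trans (base_le_blk _ j i))
  · have := (blk_inj hib (lt_of_lt_of_le hi' (((Nat.le_add_right _ 2).trans (add_two_le_b _)))) e).2
    omega

/-- Everything from `W` on is `0` after stage 1. [folklore] -/
theorem w1_of_W_le (x : List Bool) {p : ℕ} (hp : W P x.length ≤ p) : w1 P x p = false := by
  unfold w1
  rw [clEval_prog1_of_ne _ _ (fun j hj i hi e => ?_)]
  · exact inp_of_le x ((le_W _).trans hp)
  · have := blk_lt_W (P := P) hj (lt_of_lt_of_le hi ((Nat.le_add_right _ 2).trans (add_two_le_b _)))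
    omega

end Stage1

/-! ### Semantics of stage 2 -/

section Stage2

/-- "Every copy post-selects" on the assignment `w`. [folklore] -/
def allPost (n : ℕ) (w : ℕ → Bool) : Bool := (posts P n).all w

/-- "Every copy accepts". [folklore] -/
def allAcc (n : ℕ) (w : ℕ → Bool) : Bool := (outs P n).all w

/-- "Every copy rejects". [folklore] -/
def allRej (n : ℕ) (w : ℕ → Bool) : Bool := (outs P n).all fun p => !w p

/-- The value `A`: every copy post-selects and accepts. [folklore] -/
def Aval (n : ℕ) (w : ℕ → Bool) : Bool := allPost P n w && allAcc P n w

/-- The value `R`: every copy post-selects and rejects. [folklore] -/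
def Rval (n : ℕ) (w : ℕ → Bool) : Bool := allPost P n w && allRej P n w

/-- After the seed. [folklore] -/
def stA (n : ℕ) (w : ℕ → Bool) : ℕ → Bool := clEval [ClOp.not (oneW P n)] w

/-- After the chain "all copies post-select". [folklore] -/
def stB (n : ℕ) (w : ℕ → Bool) : ℕ → Bool := clEval (clChain (oneW P n) (posts P n) (cPs P n)) (stA P n w)

/-- After the chain "… and all accept". [folklore] -/
def stC (n : ℕ) (w : ℕ → Bool) : ℕ → Bool := clEval (clChain (aP P n) (outs P n) (cAs P n)) (stB P n w)

/-- After the negation of the outputs. [folklore] -/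
def stD (n : ℕ) (w : ℕ → Bool) : ℕ → Bool := clEval ((outs P n).map ClOp.not) (stC P n w)

/-- After the chain "… and all reject". [folklore] -/
def stE (n : ℕ) (w : ℕ → Bool) : ℕ → Bool := clEval (clChain (aP P n) (outs P n) (cRs P n)) (stD P n w)

/-- After the `CNOT` `aR ← aR ⊕ aA`. [folklore] -/
def stF (n : ℕ) (w : ℕ → Bool) : ℕ → Bool := clEval [ClOp.cnot (aA P n) (aR P n)] (stE P n w)

variable {P}

/-- `prog2` is the final swap layer applied to `stF`. [folklore] -/
theorem clEval_prog2_eq (n : ℕ) (w : ℕ → Bool) :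
    clEval (prog2 P n) w = clEval (swapOps [(aA P n, 0), (aR P n, 1)]) (stF P n w) := by
  simp only [prog2, clEval_append]; rfl

/-- `Aval` as a conjunction over the copies. [folklore] -/
theorem Aval_eq_true_iff (n : ℕ) (w : ℕ → Bool) :
    Aval P n w = true ↔ ∀ j < P.K, w (blk P n j 1) = true ∧ w (blk P n j 0) = true := by
  simp only [Aval, allPost, allAcc, posts, outs, Bool.and_eq_true, List.all_eq_true, List.mem_map, List.mem_range,
    forall_exists_index, and_imp, forall_apply_eq_imp_iff₂]
  exact ⟨fun h j hj => ⟨h.1 j hj, h.2 j hj⟩, fun h => ⟨fun j hj => (h j hj).1, fun j hj => (h j hj).2⟩⟩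

/-- `Rval` as a conjunction over the copies. [folklore] -/
theorem Rval_eq_true_iff (n : ℕ) (w : ℕ → Bool) :
    Rval P n w = true ↔ ∀ j < P.K, w (blk P n j 1) = true ∧ w (blk P n j 0) = false := by
  simp only [Rval, allPost, allRej, posts, outs, Bool.and_eq_true, List.all_eq_true, List.mem_map, List.mem_range,
    forall_exists_index, and_imp, forall_apply_eq_imp_iff₂, Bool.not_eq_true']
  exact ⟨fun h j hj => ⟨h.1 j hj, h.2 j hj⟩, fun h => ⟨fun j hj => (h j hj).1, fun j hj => (h j hj).2⟩⟩

/-- `A` and `R` exclude each other (there is a copy). [folklore] -/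
theorem not_Aval_and_Rval (n : ℕ) (w : ℕ → Bool) : ¬ (Aval P n w = true ∧ Rval P n w = true) := by
  rintro ⟨hA, hR⟩
  have h1 := ((Aval_eq_true_iff n w).1 hA 0 P.hK).2
  have h2 := ((Rval_eq_true_iff n w).1 hR 0 P.hK).2
  rw [h1] at h2
  exact Bool.noConfusion h2

variable {n : ℕ} {w : ℕ → Bool} (h1 : w (oneW P n) = false) (hPz : ∀ t < P.K, w (cP P n t) = false)
  (hAz : ∀ t < P.K, w (cA P n t) = false) (hRz : ∀ t < P.K, w (cR P n t) = false)

include h1 in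
/-- Stage A sets the seed. [folklore] -/
theorem stA_oneW : stA P n w (oneW P n) = true := by
  simp [stA, ClOp.eval_not, h1]

/-- Stage A changes nothing else. [folklore] -/
theorem stA_of_ne {p : ℕ} (hp : p ≠ oneW P n) : stA P n w p = w p := by
  simp [stA, ClOp.eval_not, update_of_ne hp]

include h1 hPz in
/-- **Stage B computes "all copies post-select" into `aP`.** [cite: NielsenChuang2010, §3.2.5 (Toffoli chains with ancillas)] -/
theorem stB_aP : stB P n w (aP P n) = allPost P n w := by
  unfold stB
  rw [← getLast_cPs n, clEval_clChain_getLast _ _ _ _ (by simp [posts, cPs]) (cPs_ne_nil n) (nodup_cPs n)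
    (fun l hl => by obtain ⟨j, -, rfl⟩ := mem_posts.1 hl; exact blk_not_mem_cPs n j 1)
    (fun a ha => by
      obtain ⟨t, ht, rfl⟩ := mem_cPs.1 ha
      rw [stA_of_ne (Nat.ne_of_gt (by unfold oneW cP; omega))]; exact hPz t ht),
    stA_oneW h1, Bool.true_and]
  exact List.all_congr_of_forall_mem fun p hp => stA_of_ne (by
    obtain ⟨j, -, rfl⟩ := mem_posts.1 hp
    exact Nat.ne_of_gt (lt_of_lt_of_le (oneW_lt_base n) (base_le_blk n j 1)))

/-- Stage B changes only its ancillas. [folklore] -/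
theorem stB_of_not_mem {p : ℕ} (hp : p ∉ cPs P n) : stB P n w p = stA P n w p :=
  clEval_clChain_of_not_mem _ _ _ _ hp

/-- Output wires are untouched through stages A–C. [folklore] -/
theorem stC_outs {p : ℕ} (hp : p ∈ outs P n) : stC P n w p = w p := by
  obtain ⟨j, -, rfl⟩ := mem_outs.1 hp
  unfold stC
  rw [clEval_clChain_of_not_mem _ _ _ _ (blk_not_mem_cAs n j 0), stB_of_not_mem (blk_not_mem_cPs n j 0),
    stA_of_ne (Nat.ne_of_gt (lt_of_lt_of_le (oneW_lt_base n) (base_le_blk n j 0)))]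

include h1 hPz in
/-- `aP` is untouched by stage C. [folklore] -/
theorem stC_aP : stC P n w (aP P n) = allPost P n w := by
  unfold stC
  rw [clEval_clChain_of_not_mem _ _ _ _ (aP_not_mem_cAs n), stB_aP h1 hPz]

include h1 hPz hAz in
/-- **Stage C computes `A` into `aA`.** [cite: NielsenChuang2010, §3.2.5 (Toffoli chains with ancillas)] -/
theorem stC_aA : stC P n w (aA P n) = Aval P n w := by
  unfold stC
  rw [← getLast_cAs n, clEval_clChain_getLast _ _ _ _ (by simp [outs, cAs]) (cAs_ne_nil n) (nodup_cAs n)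
    (fun l hl => by obtain ⟨j, -, rfl⟩ := mem_outs.1 hl; exact blk_not_mem_cAs n j 0)
    (fun a ha => by
      obtain ⟨t, ht, rfl⟩ := mem_cAs.1 ha
      rw [stB_of_not_mem (fun h => by obtain ⟨t', ht', e⟩ := mem_cPs.1 h; unfold cP cA at e; omega),
        stA_of_ne (Nat.ne_of_gt (by unfold oneW cA; omega))]
      exact hAz t ht),
    stB_aP h1 hPz, Aval, allAcc]
  congr 1
  exact List.all_congr_of_forall_mem fun p hp => by
    obtain ⟨j, -, rfl⟩ := mem_outs.1 hp
    rw [stB_of_not_mem (blk_not_mem_cPs n j 0), stA_of_ne (Nat.ne_of_gt (lt_of_lt_of_le (oneW_lt_base n) (base_le_blk n j 0)))]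

/-- Stage D flips the outputs. [folklore] -/
theorem stD_outs {p : ℕ} (hp : p ∈ outs P n) : stD P n w p = !stC P n w p :=
  clEval_map_not_of_mem _ (nodup_outs n) _ hp

/-- Stage D changes nothing else. [folklore] -/
theorem stD_of_not_mem {p : ℕ} (hp : p ∉ outs P n) : stD P n w p = stC P n w p :=
  clEval_map_not_of_not_mem _ _ hp

include h1 hPz hRz in
/-- **Stage E computes `R` into `aR`.** [cite: NielsenChuang2010, §3.2.5 (Toffoli chains with ancillas)] -/
theorem stE_aR : stE P n w (aR P n) = Rval P n w := by
  unfold stE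
  rw [← getLast_cRs n, clEval_clChain_getLast _ _ _ _ (by simp [outs, cRs]) (cRs_ne_nil n) (nodup_cRs n)
    (fun l hl => by obtain ⟨j, -, rfl⟩ := mem_outs.1 hl; exact blk_not_mem_cRs n j 0)
    (fun a ha => by
      obtain ⟨t, ht, rfl⟩ := mem_cRs.1 ha
      rw [stD_of_not_mem (not_mem_outs_of_lt (cR_lt_base ht))]
      unfold stC
      rw [clEval_clChain_of_not_mem _ _ _ _ (fun h => by obtain ⟨t', ht', e⟩ := mem_cAs.1 h; unfold cA cR at e; omega),
        stB_of_not_mem (fun h => by obtain ⟨t', ht', e⟩ := mem_cPs.1 h; unfold cP cR at e; omega),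
        stA_of_ne (Nat.ne_of_gt (by unfold oneW cR; omega))]
      exact hRz t ht),
    stD_of_not_mem (not_mem_outs_of_lt (aP_lt_base n)), stC_aP h1 hPz, Rval, allRej]
  congr 1
  exact List.all_congr_of_forall_mem fun p hp => by rw [stD_outs hp, stC_outs hp]

include h1 hPz hAz in
/-- `aA` still holds `A` after stage E. [folklore] -/
theorem stE_aA : stE P n w (aA P n) = Aval P n w := by
  unfold stE
  rw [clEval_clChain_of_not_mem _ _ _ _ (aA_not_mem_cRs n), stD_of_not_mem (not_mem_outs_of_lt (aA_lt_base n)), stC_aA h1 hPz hAz]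

include h1 hPz hAz in
/-- After stage F, `aA` holds `A`. [folklore] -/
theorem stF_aA : stF P n w (aA P n) = Aval P n w := by
  unfold stF
  rw [clEval_cons, clEval_nil, ClOp.eval_apply_of_ne _ _ (by exact aA_ne_aR n)]
  exact stE_aA h1 hPz hAz

include h1 hPz hAz hRz in
/-- After stage F, `aR` holds `R ⊕ A`. [folklore] -/
theorem stF_aR : stF P n w (aR P n) = (Rval P n w ^^ Aval P n w) := by
  unfold stF
  rw [clEval_cons, clEval_nil, ClOp.eval_cnot, update_self, stE_aR h1 hPz hRz, stE_aA h1 hPz hAz]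

/-- The hypotheses of the final swap layer. [folklore] -/
theorem swap_hyps (n : ℕ) :
    (([(aA P n, 0), (aR P n, 1)] : List (ℕ × ℕ)).map Prod.fst).Nodup ∧ (([(aA P n, 0), (aR P n, 1)] : List (ℕ × ℕ)).map Prod.snd).Nodup ∧
      ∀ p ∈ ([(aA P n, 0), (aR P n, 1)] : List (ℕ × ℕ)), ∀ q ∈ ([(aA P n, 0), (aR P n, 1)] : List (ℕ × ℕ)), p.1 ≠ q.2 := by
  have hA := two_lt_aA (P := P) n
  have hR := two_lt_aR (P := P) n
  refine ⟨by simp [aA_ne_aR n], by simp, fun p hp q hq => ?_⟩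
  simp only [List.mem_cons, List.not_mem_nil, or_false] at hp hq
  rcases hp with rfl | rfl <;> rcases hq with rfl | rfl <;> simp only <;> omega

include h1 hPz hAz in
/-- **Stage 2 writes `A` on wire `0`.** [cite: BremnerJozsaShepherdPRSA2011, §2.4 p. 6 (single-line registers via a simple reversible function)] -/
theorem clEval_prog2_zero : clEval (prog2 P n) w 0 = Aval P n w := by
  obtain ⟨hsnd, -, -⟩ := clEval_swapOps _ (swap_hyps (P := P) n).1 (swap_hyps n).2.1 (swap_hyps n).2.2 (stF P n w)
  rw [clEval_prog2_eq, hsnd (aA P n, 0) (by simp)]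
  exact stF_aA h1 hPz hAz

include h1 hPz hAz hRz in
/-- **Stage 2 writes `R ⊕ A` (`= A ∨ R`) on wire `1`.** [cite: BremnerJozsaShepherdPRSA2011, §2.4 p. 6 (single-line registers via a simple reversible function)] -/
theorem clEval_prog2_one : clEval (prog2 P n) w 1 = (Rval P n w ^^ Aval P n w) := by
  obtain ⟨hsnd, -, -⟩ := clEval_swapOps _ (swap_hyps (P := P) n).1 (swap_hyps n).2.1 (swap_hyps n).2.2 (stF P n w)
  rw [clEval_prog2_eq, hsnd (aR P n, 1) (by simp)]
  exact stF_aR h1 hPz hAz hRz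

end Stage2

/-! ## Part II. The circuits, the family, and the matrices of the stages -/

/-! ### Compilation on `n + anc n` wires -/

section Compile

variable {P}

/-- `prog1` fits. [folklore] -/
theorem prog1_lt' (n : ℕ) : ∀ op ∈ prog1 P n, ∀ i ∈ wiresOf op, i < n + anc P n := by
  rw [n_add_anc]; exact prog1_lt n

/-- `progConj n j` fits (for `j < K`). [folklore] -/
theorem progConj_lt' {n j : ℕ} (hj : j < P.K) : ∀ op ∈ progConj P n j, ∀ i ∈ wiresOf op, i < n + anc P n := by
  rw [n_add_anc]; exact progConj_lt hj

/-- `prog2` fits. [folklore] -/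
theorem prog2_lt' (n : ℕ) : ∀ op ∈ prog2 P n, ∀ i ∈ wiresOf op, i < n + anc P n := by
  rw [n_add_anc]; exact prog2_lt n

/-- The copy fits into the register. [folklore] -/
theorem copy_fits' (n : ℕ) : n + P.F.ancillas n ≤ n + anc P n := by
  rw [n_add_anc]; exact (copy_fits n).trans ((b_lt_base n).le.trans (base_le_W n))

/-- The front window fits into the register. [folklore] -/
theorem b_fits (n : ℕ) : b P n ≤ n + anc P n := by
  rw [n_add_anc]; exact (b_lt_base n).le.trans (base_le_W n)

variable (P)

/-- A program over `ℕ` with wires below `n + anc n`, re-indexed to `Fin (n + anc n)` and turned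
into reversible operations (`RevGadgets.toRevList`). [cite: AroraBarak2009, §10.3.7 Lemma 10.10] -/
def clamp (n : ℕ) (ops : List (ClOp ℕ)) (hlt : ∀ op ∈ ops, ∀ i ∈ wiresOf op, i < n + anc P n)
    (hwf : ∀ op ∈ ops, op.WF) : List (RevOp (n + anc P n)) :=
  toRevList (ops.map (ClOp.map (finOf (n + anc P n) (width_pos n)))) fun op hop => by
    simp only [List.mem_map] at hop
    obtain ⟨op, hop, rfl⟩ := hop
    exact wf_map_finOf _ (hlt op hop) (hwf op hop)

/-- **Semantics of a clamped program**: on `Fin (n + anc n)` it acts as the `ℕ`-program on the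
lifted assignment. [folklore] -/
theorem revEval_clamp (n : ℕ) (ops : List (ClOp ℕ)) (hlt : ∀ op ∈ ops, ∀ i ∈ wiresOf op, i < n + anc P n)
    (hwf : ∀ op ∈ ops, op.WF) (w : QReg (n + anc P n)) (p : Fin (n + anc P n)) :
    revEval (clamp P n ops hlt hwf) w p = clEval ops (liftW w) p := by
  unfold clamp
  rw [revEval_toRevList, clEval_map_finOf_apply _ ops hlt]

/-! ### The circuits -/

/-- Stage 1, compiled. [folklore] -/
def stage1 (n : ℕ) : List (QGate cliffordT (n + anc P n)) :=
  revCompile (clamp P n (prog1 P n) (prog1_lt' n) (prog1_wf n))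

/-- **The conjugating swap of block `j`**, compiled (empty for `j ≥ K`). [cite: NielsenChuang2010, §1.3.4 (swap from three CNOTs)] -/
def conjGates (n j : ℕ) : List (QGate cliffordT (n + anc P n)) :=
  if h : j < P.K then revCompile (clamp P n (progConj P n j) (progConj_lt' h) (progConj_wf n j)) else []

/-- **The copy**: `F.circ n` on the front wires, verbatim. [cite: AroraBarak2009, §6.2 (a circuit for each input length, hard-wired)] -/
def copyGates (n : ℕ) : List (QGate cliffordT (n + anc P n)) :=
  (mapWires (Fin.castLEEmb (copy_fits' n)) (P.F.circ n)).gates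

/-- The quantum stage: for every `j < K`, swap, copy, swap back. [folklore] -/
def stageQ (n : ℕ) : List (QGate cliffordT (n + anc P n)) :=
  (List.range P.K).flatMap fun j => conjGates P n j ++ (copyGates P n ++ conjGates P n j)

/-- Stage 2, compiled. [folklore] -/
def stage2 (n : ℕ) : List (QGate cliffordT (n + anc P n)) :=
  revCompile (clamp P n (prog2 P n) (prog2_lt' n) (prog2_wf n))

/-- **The circuit of the amplified family on inputs of length `n`.** [cite: BremnerJozsaShepherdPRSA2011, §2.4 p. 6 (multiple runs of the circuit)] -/
def circ (n : ℕ) : QCircuit cliffordT (n + anc P n) := ⟨stage1 P n ++ (stageQ P n ++ stage2 P n)⟩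

/-- **The amplified family.** [cite: BremnerJozsaShepherdPRSA2011, §2.4 p. 6 (multiple runs of the circuit)] -/
def family : QCircuitFamily cliffordT := ⟨anc P, circ P⟩

/-- The circuit of the family (definitional). [folklore] -/
@[simp] theorem family_circ (n : ℕ) : (family P).circ n = circ P n := rfl

/-- The ancillas of the family (definitional). [folklore] -/
@[simp] theorem family_ancillas (n : ℕ) : (family P).ancillas n = anc P n := rfl

/-- **The amplified family is oracle-free** (if the given one is). [folklore] -/
theorem family_isOracleFree (hF : P.F.IsOracleFree) : (family P).IsOracleFree := by
  intro n g hg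
  have hg' : g ∈ stage1 P n ++ (stageQ P n ++ stage2 P n) := hg
  rcases List.mem_append.1 hg' with h | h
  · exact revCompile_isOracleFree (clamp P n (prog1 P n) (prog1_lt' n) (prog1_wf n)) g h
  rcases List.mem_append.1 h with h | h
  · obtain ⟨j, -, h⟩ := List.mem_flatMap.1 h
    have hconj : g ∈ conjGates P n j → g.IsOracleFree := fun h => by
      unfold conjGates at h
      split_ifs at h with hj
      · exact revCompile_isOracleFree (clamp P n (progConj P n j) (progConj_lt' hj) (progConj_wf n j)) g h
      · exact absurd h List.not_mem_nil
    rcases List.mem_append.1 h with h | h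
    · exact hconj h
    rcases List.mem_append.1 h with h | h
    · exact isOracleFree_mapWires _ (hF n) g h
    · exact hconj h
  · exact revCompile_isOracleFree (clamp P n (prog2 P n) (prog2_lt' n) (prog2_wf n)) g h

end Compile

/-! ### Stage 1 on the input -/

section Stage1Matrix

/-- The basis label after stage 1 on the input `x`. [folklore] -/
def W1 (x : List Bool) : QReg (x.length + anc P x.length) := fun p => w1 P x p

variable {P}

/-- **Stage 1 on a basis state.** [cite: AroraBarak2009, §10.3.7 Lemma 10.10] -/
theorem toMatrix_stage1_mulVec_basisState (A : Language Bool) (n : ℕ) (w : QReg (n + anc P n)) :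
    (⟨stage1 P n⟩ : QCircuit cliffordT (n + anc P n)).toMatrix A *ᵥ basisState w =
      basisState (fun p => clEval (prog1 P n) (liftW w) p) := by
  rw [stage1, revCompile_mulVec_basisState]
  congr 1
  funext p
  exact revEval_clamp P n _ _ _ w p

/-- **Stage 1 on the input `|x 0…0⟩` yields `|w1 x⟩`.** [cite: AroraBarak2009, §10.3.7 Lemma 10.10] -/
theorem toMatrix_stage1_mulVec_pad (A : Language Bool) (x : List Bool) :
    (⟨stage1 P x.length⟩ : QCircuit cliffordT (x.length + anc P x.length)).toMatrix A *ᵥ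
        basisState (padInput x.get (anc P x.length)) = basisState (W1 P x) := by
  rw [toMatrix_stage1_mulVec_basisState, liftW_padInput_get]
  rfl

end Stage1Matrix

/-! ### The conjugating swap -/

section Conj

variable {P} {n j : ℕ} (hj : j < P.K)

include hj in
/-- Block wires fit. [folklore] -/
theorem blk_fits {i : ℕ} (hi : i < b P n) : blk P n j i < n + anc P n := by
  rw [n_add_anc]; exact blk_lt_W hj hi

/-- **The wire involution of the conjugating swap**: front wire `i < b n` ↔ wire `i` of block
`j`, all other wires fixed. [cite: NielsenChuang2010, §1.3.4 (swap from three CNOTs)] -/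
def conjInvol (hj : j < P.K) (p : Fin (n + anc P n)) : Fin (n + anc P n) :=
  if h1 : (p : ℕ) < b P n then ⟨blk P n j p, blk_fits hj h1⟩
  else if h2 : blk P n j 0 ≤ p ∧ (p : ℕ) < blk P n j 0 + b P n then
    ⟨p - blk P n j 0, by have := p.isLt; omega⟩
  else p

/-- `conjInvol` on a front wire. [folklore] -/
theorem conjInvol_of_lt {p : Fin (n + anc P n)} (hp : (p : ℕ) < b P n) : (conjInvol hj p : ℕ) = blk P n j p := by
  unfold conjInvol; rw [dif_pos hp]

/-- `conjInvol` on a block wire. [folklore] -/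
theorem conjInvol_blk {i : ℕ} (hi : i < b P n) : (conjInvol hj ⟨blk P n j i, blk_fits hj hi⟩ : ℕ) = i := by
  have h1 : ¬ blk P n j i < b P n := Nat.not_lt.2 ((b_lt_base n).le.trans (base_le_blk n j i))
  have h2 : blk P n j 0 ≤ blk P n j i ∧ blk P n j i < blk P n j 0 + b P n := by rw [blk_eq_add n j i]; omega
  unfold conjInvol
  rw [dif_neg h1, dif_pos h2]
  simp [blk_eq_add n j i]

/-- `conjInvol` elsewhere. [folklore] -/
theorem conjInvol_of_not {p : Fin (n + anc P n)} (hp : ¬ (p : ℕ) < b P n)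
    (hp' : ¬ (blk P n j 0 ≤ p ∧ (p : ℕ) < blk P n j 0 + b P n)) : conjInvol hj p = p := by
  unfold conjInvol; rw [dif_neg hp, dif_neg hp']

/-- **`conjInvol` is an involution.** [folklore] -/
theorem conjInvol_conjInvol (p : Fin (n + anc P n)) : conjInvol hj (conjInvol hj p) = p := by
  have hb := (b_lt_base (P := P) n).le.trans (base_le_blk n j 0)
  by_cases h1 : (p : ℕ) < b P n
  · have e : conjInvol hj p = ⟨blk P n j p, blk_fits hj h1⟩ := by unfold conjInvol; rw [dif_pos h1]
    rw [e]
    exact Fin.ext (conjInvol_blk hj h1)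
  · by_cases h2 : blk P n j 0 ≤ p ∧ (p : ℕ) < blk P n j 0 + b P n
    · have hi : (p : ℕ) - blk P n j 0 < b P n := by omega
      have e : conjInvol hj p = ⟨p - blk P n j 0, by have := p.isLt; omega⟩ := by
        unfold conjInvol; rw [dif_neg h1, dif_pos h2]
      rw [e]
      apply Fin.ext
      rw [conjInvol_of_lt hj (by exact hi)]
      simp only
      rw [blk_eq_add n j]; omega
    · rw [conjInvol_of_not hj h1 h2, conjInvol_of_not hj h1 h2]

/-- **The compiled conjugating swap permutes basis states along `conjInvol`.** [cite: NielsenChuang2010, §1.3.4 (swap from three CNOTs)] -/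
theorem toMatrix_conjGates_mulVec_basisState (A : Language Bool) (w : QReg (n + anc P n)) :
    (⟨conjGates P n j⟩ : QCircuit cliffordT (n + anc P n)).toMatrix A *ᵥ basisState w = basisState (w ∘ conjInvol hj) := by
  unfold conjGates
  rw [dif_pos hj, revCompile_mulVec_basisState]
  congr 1
  funext p
  rw [revEval_clamp]
  unfold progConj
  have hb := (b_lt_base (P := P) n).le.trans (base_le_blk n j 0)
  -- the hypotheses of `clEval_swapOps`
  have h1 : ((conjPairs P n j).map Prod.fst).Nodup := by
    rw [conjPairs, List.map_map]; simpa [Function.comp_def] using List.nodup_range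
  have h2 : ((conjPairs P n j).map Prod.snd).Nodup := by
    rw [conjPairs, List.map_map]
    exact List.nodup_range.map_on fun a _ c _ h => by simp only [Function.comp_apply] at h; unfold blk at h; omega
  have h12 : ∀ q ∈ conjPairs P n j, ∀ q' ∈ conjPairs P n j, q.1 ≠ q'.2 := by
    intro q hq q' hq'
    simp only [conjPairs, List.mem_map, List.mem_range] at hq hq'
    obtain ⟨i, hi, rfl⟩ := hq; obtain ⟨i', -, rfl⟩ := hq'
    exact Nat.ne_of_lt (lt_of_lt_of_le hi ((b_lt_base n).le.trans (base_le_blk n j i')))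
  obtain ⟨hsnd, hfst, hother⟩ := clEval_swapOps (conjPairs P n j) h1 h2 h12 (liftW w)
  simp only [Function.comp_apply]
  by_cases hp : (p : ℕ) < b P n
  · -- a front wire receives the block wire
    have hmem : ((p : ℕ), blk P n j p) ∈ conjPairs P n j := List.mem_map.2 ⟨p, List.mem_range.2 hp, rfl⟩
    rw [hfst _ hmem]
    change liftW w (blk P n j p) = w (conjInvol hj p)
    rw [← liftW_val w (conjInvol hj p), conjInvol_of_lt hj hp]
  · by_cases hp2 : blk P n j 0 ≤ p ∧ (p : ℕ) < blk P n j 0 + b P n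
    · -- a block wire receives the front wire
      have hi : (p : ℕ) - blk P n j 0 < b P n := by omega
      have hpe : (p : ℕ) = blk P n j (p - blk P n j 0) := by rw [blk_eq_add n j]; omega
      have hmem : ((p : ℕ) - blk P n j 0, (p : ℕ)) ∈ conjPairs P n j :=
        List.mem_map.2 ⟨_, List.mem_range.2 hi, by rw [← hpe]⟩
      rw [hsnd _ hmem]
      change liftW w ((p : ℕ) - blk P n j 0) = w (conjInvol hj p)
      rw [← liftW_val w (conjInvol hj p)]
      congr 1
      unfold conjInvol; rw [dif_neg hp, dif_pos hp2]
    · rw [hother _ (fun q hq => ?_), conjInvol_of_not hj hp hp2, liftW_val]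
      simp only [conjPairs, List.mem_map, List.mem_range] at hq
      obtain ⟨i, hi, rfl⟩ := hq
      refine ⟨fun h => hp (h ▸ hi), fun h => hp2 ?_⟩
      rw [h, blk_eq_add n j i]; omega

/-- **Swap–copy–swap computes the copy transported along `conjInvol`.** [cite: NielsenChuang2010, §4.3 (a gate on a subset of the wires is U ⊗ 1 up to the order of the factors)] -/
theorem toMatrix_conjBlock (A : Language Bool) :
    (⟨conjGates P n j ++ (copyGates P n ++ conjGates P n j)⟩ : QCircuit cliffordT (n + anc P n)).toMatrix A =
      (mapWires ((Fin.castLEEmb (copy_fits' n)).trans (invEmb (conjInvol hj) (conjInvol_conjInvol hj))) (P.F.circ n)).toMatrix A :=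
  toMatrix_conj_mapWires A (conjInvol hj) (conjInvol_conjInvol hj) (conjGates P n j)
    (toMatrix_conjGates_mulVec_basisState hj A) (Fin.castLEEmb (copy_fits' n)) (P.F.circ n)

end Conj

/-! ### The blocks and the quantum stage -/

section Blocks

variable (n : ℕ)

/-- Block `j` as an embedding of `b n` wires. [folklore] -/
def blockEmb (j : Fin P.K) : Fin (b P n) ↪ Fin (n + anc P n) :=
  ⟨fun i => ⟨blk P n j i, blk_fits j.isLt i.isLt⟩, fun _ _ h => Fin.ext (blk_inj (P := P) (Fin.isLt _) (Fin.isLt _) (congrArg Fin.val h)).2⟩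

/-- The copy, padded to the block width. [folklore] -/
def Cpad : QCircuit cliffordT (b P n) := mapWires (Fin.castLEEmb (copy_fits n)) (P.F.circ n)

variable {P n}

/-- `blockEmb` evaluated. [folklore] -/
@[simp] theorem blockEmb_apply_val (j : Fin P.K) (i : Fin (b P n)) : (blockEmb P n j i : ℕ) = blk P n j i := rfl

/-- **The blocks are pairwise disjoint.** [folklore] -/
theorem blockDisjoint : BlockDisjoint (blockEmb P n) := by
  intro j j' hne
  refine Set.disjoint_left.2 ?_
  rintro w ⟨i, rfl⟩ ⟨i', hi'⟩
  have h := congrArg Fin.val hi'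
  simp only [blockEmb_apply_val] at h
  exact hne (Fin.ext (blk_inj i'.isLt i.isLt h).1).symm

/-- Off the blocks means below `base`. [folklore] -/
theorem offBlocks_iff (w : Fin (n + anc P n)) : OffBlocks (blockEmb P n) w ↔ (w : ℕ) < base P n := by
  constructor
  · intro h
    by_contra hlt
    push Not at hlt
    have hB : 0 < b P n := lt_of_lt_of_le Nat.zero_lt_two (two_le_b n)
    have hw : (w : ℕ) < W P n := by rw [← n_add_anc]; exact w.isLt
    set d := (w : ℕ) - base P n with hd
    have hdlt : d < P.K * b P n := by unfold W at hw; omega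
    have hjlt : d / b P n < P.K := (Nat.div_lt_iff_lt_mul hB).2 hdlt
    have hilt : d % b P n < b P n := Nat.mod_lt _ hB
    refine h ⟨d / b P n, hjlt⟩ ⟨⟨d % b P n, hilt⟩, Fin.ext ?_⟩
    simp only [blockEmb_apply_val]
    unfold blk
    have := Nat.div_add_mod d (b P n)
    rw [Nat.mul_comm] at this
    omega
  · rintro hw j ⟨i, rfl⟩
    exact absurd (base_le_blk (P := P) n j i) (Nat.not_le.2 hw)

/-- Swap–copy–swap of block `j` is the padded copy embedded on block `j`, matrix-wise. [folklore] -/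
theorem toMatrix_conjBlock_eq (A : Language Bool) (j : Fin P.K) :
    (⟨conjGates P n j ++ (copyGates P n ++ conjGates P n j)⟩ : QCircuit cliffordT (n + anc P n)).toMatrix A =
      (mapWires (blockEmb P n j) (Cpad P n)).toMatrix A := by
  rw [toMatrix_conjBlock j.isLt, toMatrix_mapWires, Cpad, toMatrix_mapWires, toMatrix_mapWires, placeGate_placeGate]
  congr 1
  ext i
  simp only [Function.Embedding.trans_apply, Fin.castLEEmb_apply, blockEmb_apply_val, Fin.val_castLE, invEmb_apply]
  exact conjInvol_of_lt j.isLt (lt_of_lt_of_le i.isLt (copy_fits n))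

/-- **The quantum stage is the product of the padded copies on the blocks, matrix-wise.**
[cite: NielsenChuang2010, §4.3 (a gate on a subset of the wires is U ⊗ 1 up to the order of the factors)] -/
theorem toMatrix_stageQ (A : Language Bool) :
    (⟨stageQ P n⟩ : QCircuit cliffordT (n + anc P n)).toMatrix A =
      (⟨(List.finRange P.K).flatMap fun j => (mapWires (blockEmb P n j) (Cpad P n)).gates⟩ :
        QCircuit cliffordT (n + anc P n)).toMatrix A := by
  have hl : stageQ P n = (List.finRange P.K).flatMap fun j : Fin _ =>
      conjGates P n j ++ (copyGates P n ++ conjGates P n j) := by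
    rw [stageQ, ← List.map_coe_finRange_eq_range, List.flatMap_map]
  rw [hl]
  exact toMatrix_flatMap_congr A _ _ _ fun j _ => toMatrix_conjBlock_eq A j

variable (P) (x : List Bool)

/-- The padded input, padded further to the block width: `x`, `0^{F.ancillas |x|}`, zeros. [folklore] -/
def padBlock : QReg (b P x.length) :=
  padInput (padInput x.get (P.F.ancillas x.length)) (b P x.length - (x.length + P.F.ancillas x.length)) ∘
    Fin.cast (Nat.add_sub_cancel' (copy_fits x.length)).symm

/-- The block state after the quantum stage (the same for every block). [folklore] -/
def blockState : QReg (b P x.length) → ℂ := (Cpad P x.length).toMatrix 0 *ᵥ basisState (padBlock P x)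

variable {P x}

/-- `padBlock` on a data wire. [folklore] -/
theorem padBlock_of_lt (i : Fin (b P x.length)) (hi : (i : ℕ) < x.length) : padBlock P x i = x.get ⟨i, hi⟩ := by
  have e1 : Fin.cast (Nat.add_sub_cancel' (copy_fits x.length)).symm i =
      Fin.castAdd (b P x.length - (x.length + P.F.ancillas x.length)) (Fin.castAdd (P.F.ancillas x.length) ⟨i, hi⟩) := Fin.ext rfl
  simp only [padBlock, Function.comp_apply]
  rw [e1, padInput, Fin.append_left, padInput, Fin.append_left]

/-- `padBlock` beyond the data wires is `0`. [folklore] -/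
theorem padBlock_of_le (i : Fin (b P x.length)) (hi : x.length ≤ (i : ℕ)) : padBlock P x i = false := by
  simp only [padBlock, Function.comp_apply]
  by_cases hi2 : (i : ℕ) < x.length + P.F.ancillas x.length
  · have e1 : Fin.cast (Nat.add_sub_cancel' (copy_fits x.length)).symm i =
        Fin.castAdd (b P x.length - (x.length + P.F.ancillas x.length))
          (Fin.natAdd x.length ⟨i - x.length, by omega⟩) := Fin.ext (by simp; omega)
    rw [e1, padInput, Fin.append_left, padInput, Fin.append_right]
  · have e1 : Fin.cast (Nat.add_sub_cancel' (copy_fits x.length)).symm i =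
        Fin.natAdd (x.length + P.F.ancillas x.length) ⟨i - (x.length + P.F.ancillas x.length), by have := i.isLt; omega⟩ :=
      Fin.ext (by simp; omega)
    rw [e1, padInput, Fin.append_right]

/-- **The content of every block after stage 1 is the padded input.** [folklore] -/
theorem W1_comp_blockEmb (j : Fin P.K) : W1 P x ∘ blockEmb P x.length j = padBlock P x := by
  funext i
  simp only [Function.comp_apply, W1]
  change w1 P x (blk P x.length j i) = _
  by_cases hi : (i : ℕ) < x.length
  · rw [w1_blk_of_lt x j.isLt hi, padBlock_of_lt i hi, List.getD_eq_getElem _ _ hi]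
    rfl
  · rw [w1_blk_of_le x (Nat.not_lt.1 hi) i.isLt, padBlock_of_le i (Nat.not_lt.1 hi)]

/-- **The state after the quantum stage is the product state of the block states** (off the
blocks: `w1 x`). [cite: NielsenChuang2010, §2.1.7 eq. (2.45)] -/
theorem stageQ_mulVec_W1 :
    (⟨stageQ P x.length⟩ : QCircuit cliffordT (x.length + anc P x.length)).toMatrix 0 *ᵥ basisState (W1 P x) =
      prodState (blockEmb P x.length) (fun _ => blockState P x) (W1 P x) := by
  rw [toMatrix_stageQ, basisState_eq_prodState (blockEmb P x.length) (W1 P x),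
    toMatrix_flatMap_mapWires_mulVec_prodState 0 blockDisjoint]
  congr 1
  funext j
  rw [W1_comp_blockEmb j]
  rfl

end Blocks

/-! ### Stage 2 as a permutation of the basis labels -/

section Stage2Matrix

variable (n : ℕ)

/-- **Stage 2 as an injective self-map of the basis labels.** [cite: NielsenChuang2010, §3.2.5 (reversible classical computation on basis states)] -/
def perm2 : QReg (n + anc P n) ↪ QReg (n + anc P n) :=
  ⟨revEval (clamp P n (prog2 P n) (prog2_lt' n) (prog2_wf n)), by
    unfold clamp
    intro a c h
    rw [revEval_toRevList, revEval_toRevList] at h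
    exact clEval_injective _ (fun op hop => by
      simp only [List.mem_map] at hop
      obtain ⟨op, hop, rfl⟩ := hop
      exact wf_map_finOf _ (prog2_lt' n op hop) (prog2_wf n op hop)) h⟩

variable {P n}

/-- `perm2` evaluated: the `ℕ`-program on the lifted assignment. [folklore] -/
theorem perm2_apply (z : QReg (n + anc P n)) (p : Fin (n + anc P n)) :
    perm2 P n z p = clEval (prog2 P n) (liftW z) p :=
  revEval_clamp P n _ _ _ z p

/-- **Stage 2 permutes basis states along `perm2`.** [cite: AroraBarak2009, §10.3.7 Lemma 10.10] -/
theorem toMatrix_stage2_mulVec_basisState (A : Language Bool) (z : QReg (n + anc P n)) :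
    (⟨stage2 P n⟩ : QCircuit cliffordT (n + anc P n)).toMatrix A *ᵥ basisState z = basisState (perm2 P n z) := by
  rw [stage2, revCompile_mulVec_basisState]
  rfl

/-- **The final state**: stage 2 applied to the product state. [folklore] -/
theorem runOn_circ (x : List Bool) :
    (circ P x.length).runOn 0 (basisState (padInput x.get (anc P x.length))) =
      (⟨stage2 P x.length⟩ : QCircuit cliffordT (x.length + anc P x.length)).toMatrix 0 *ᵥ
        prodState (blockEmb P x.length) (fun _ => blockState P x) (W1 P x) := by
  rw [QCircuit.runOn, circ, show (⟨stage1 P x.length ++ (stageQ P x.length ++ stage2 P x.length)⟩ :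
      QCircuit cliffordT (x.length + anc P x.length)) =
      (⟨stage1 P x.length⟩ : QCircuit cliffordT _).append ((⟨stageQ P x.length⟩ : QCircuit cliffordT _).append ⟨stage2 P x.length⟩)
      from rfl, QCircuit.toMatrix_append, QCircuit.toMatrix_append, ← Matrix.mulVec_mulVec, ← Matrix.mulVec_mulVec,
    toMatrix_stage1_mulVec_pad, stageQ_mulVec_W1]

end Stage2Matrix

/-! ## Part III. The post-selected weights of the amplified family -/

section Weights

variable (x : List Bool)

/-- The weight of "accept and post-select" of one copy on `x`:
`∑_{u : u₀ = u₁ = 1} |⟨u| U |x 0…0⟩|²` (`= F.jointAcceptProbOn 0 x`, `accW_eq`). [cite: Aaronson2005, Def. 1] -/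
def accW : ℝ :=
  ∑ u : QReg (x.length + P.F.ancillas x.length),
    if (∃ h : 1 < x.length + P.F.ancillas x.length, u ⟨0, by omega⟩ = true ∧ u ⟨1, h⟩ = true) then
      ‖(P.F.circ x.length).toMatrix 0 u (padInput x.get (P.F.ancillas x.length))‖ ^ 2 else 0

/-- The weight of "reject and post-select" of one copy on `x`:
`∑_{u : u₀ = 0, u₁ = 1} |⟨u| U |x 0…0⟩|²`. [cite: Aaronson2005, Def. 1] -/
def rejW : ℝ :=
  ∑ u : QReg (x.length + P.F.ancillas x.length),
    if (∃ h : 1 < x.length + P.F.ancillas x.length, u ⟨0, by omega⟩ = false ∧ u ⟨1, h⟩ = true) then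
      ‖(P.F.circ x.length).toMatrix 0 u (padInput x.get (P.F.ancillas x.length))‖ ^ 2 else 0

variable {P x}

/-- `accW ≥ 0`. [folklore] -/
theorem accW_nonneg : 0 ≤ accW P x := Finset.sum_nonneg fun _ _ => by split_ifs <;> positivity

/-- `rejW ≥ 0`. [folklore] -/
theorem rejW_nonneg : 0 ≤ rejW P x := Finset.sum_nonneg fun _ _ => by split_ifs <;> positivity

/-- A Born probability of an event as a sum of indicator-weighted squared amplitudes. [folklore] -/
theorem probEvent_eq_sum_ite {G : QGateSet} {N : ℕ} (A : Language Bool) (C : QCircuit G N) (ψ : QReg N → ℂ) (E : Set (QReg N))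
    [DecidablePred (· ∈ E)] : C.probEvent A ψ E = ∑ y, if y ∈ E then ‖(C.runOn A ψ) y‖ ^ 2 else 0 := by
  classical
  unfold QCircuit.probEvent
  rw [Finset.sum_filter]
  exact Finset.sum_congr rfl fun y _ => by congr 1

/-- **`accW` is the joint acceptance probability of the given family.** [cite: Aaronson2005, Def. 1] -/
theorem accW_eq : accW P x = P.F.jointAcceptProbOn 0 x := by
  classical
  unfold accW QCircuitFamily.jointAcceptProbOn QCircuit.jointAcceptProb
  rw [probEvent_eq_sum_ite]
  refine Finset.sum_congr rfl fun u _ => ?_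
  simp only [QCircuit.jointAcceptEvent, Set.mem_setOf_eq, QCircuit.runOn, mulVec_basisState]

/-- **`accW + rejW` is the post-selection probability of the given family.** [cite: Aaronson2005, Def. 1] -/
theorem accW_add_rejW : accW P x + rejW P x = P.F.postselectProbOn 0 x := by
  classical
  unfold accW rejW QCircuitFamily.postselectProbOn QCircuit.postselectProb
  rw [probEvent_eq_sum_ite, ← Finset.sum_add_distrib]
  refine Finset.sum_congr rfl fun u _ => ?_
  simp only [QCircuit.postselectEvent, Set.mem_setOf_eq, QCircuit.runOn, mulVec_basisState]
  by_cases h : 1 < x.length + P.F.ancillas x.length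
  · cases hu0 : u ⟨0, by omega⟩ <;> by_cases hu1 : u ⟨1, h⟩ = true <;> simp [h, hu0, hu1]
  · simp [h]

/-- Without two wires there is no post-selection. [folklore] -/
theorem postselectProbOn_eq_zero_of_lt {G : QGateSet} (F : QCircuitFamily G) (A : Language Bool) (x : List Bool)
    (h : x.length + F.ancillas x.length < 2) : F.postselectProbOn A x = 0 := by
  classical
  unfold QCircuitFamily.postselectProbOn QCircuit.postselectProb
  rw [probEvent_eq_sum_ite]
  refine Finset.sum_eq_zero fun y _ => ?_
  rw [if_neg]
  rintro ⟨h', -⟩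
  omega

/-! ### Block events -/

/-- "Accept and post-select" read off a block content. [folklore] -/
def accB {n : ℕ} (v : QReg (b P n)) : Prop :=
  v ⟨0, lt_of_lt_of_le Nat.zero_lt_two (two_le_b n)⟩ = true ∧ v ⟨1, lt_of_lt_of_le Nat.one_lt_two (two_le_b n)⟩ = true

/-- "Reject and post-select" read off a block content. [folklore] -/
def rejB {n : ℕ} (v : QReg (b P n)) : Prop :=
  v ⟨0, lt_of_lt_of_le Nat.zero_lt_two (two_le_b n)⟩ = false ∧ v ⟨1, lt_of_lt_of_le Nat.one_lt_two (two_le_b n)⟩ = true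

/-- `accB` is decidable. [folklore] -/
instance instDecidableAccB {n : ℕ} (v : QReg (b P n)) : Decidable (accB (P := P) v) := by unfold accB; infer_instance

/-- `rejB` is decidable. [folklore] -/
instance instDecidableRejB {n : ℕ} (v : QReg (b P n)) : Decidable (rejB (P := P) v) := by unfold rejB; infer_instance

/-- `padBlock` restricted to the copy is the padded input. [folklore] -/
theorem padBlock_comp_castLE : padBlock P x ∘ Fin.castLEEmb (copy_fits x.length) = padInput x.get (P.F.ancillas x.length) := by
  funext i
  simp only [Function.comp_apply]
  by_cases hi : (i : ℕ) < x.length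
  · rw [padBlock_of_lt _ (by exact hi)]
    have e : i = Fin.castAdd (P.F.ancillas x.length) ⟨i, hi⟩ := Fin.ext rfl
    conv_rhs => rw [e, padInput, Fin.append_left]
    rfl
  · rw [padBlock_of_le _ (by exact Nat.not_lt.1 hi)]
    have e : i = Fin.natAdd x.length ⟨i - x.length, by have := i.isLt; omega⟩ := Fin.ext (by simp; omega)
    conv_rhs => rw [e, padInput, Fin.append_right]

/-- **The block weight of "accept and post-select" is `accW`** (for a copy with at least two wires). [cite: NielsenChuang2010, §2.2.8 (measurement of one register of a product state)] -/
theorem sum_blockState_accB (h2 : 2 ≤ x.length + P.F.ancillas x.length) :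
    (∑ v : QReg (b P x.length), if accB v then ‖blockState P x v‖ ^ 2 else 0) = accW P x := by
  classical
  have hT : ∀ v : QReg (b P x.length), accB v ↔
      ((v ∘ Fin.castLEEmb (copy_fits x.length)) ⟨0, by omega⟩ = true ∧ (v ∘ Fin.castLEEmb (copy_fits x.length)) ⟨1, by omega⟩ = true) :=
    fun v => Iff.rfl
  simp only [blockState, Cpad, toMatrix_mapWires]
  rw [show (∑ v : QReg (b P x.length), if accB v then ‖(placeGate (Fin.castLEEmb (copy_fits x.length)) ((P.F.circ x.length).toMatrix 0) *ᵥ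
      basisState (padBlock P x)) v‖ ^ 2 else 0) = ∑ v : QReg (b P x.length),
      if ((v ∘ Fin.castLEEmb (copy_fits x.length)) ⟨0, by omega⟩ = true ∧ (v ∘ Fin.castLEEmb (copy_fits x.length)) ⟨1, by omega⟩ = true) then
        ‖(placeGate (Fin.castLEEmb (copy_fits x.length)) ((P.F.circ x.length).toMatrix 0) *ᵥ basisState (padBlock P x)) v‖ ^ 2 else 0
    from Finset.sum_congr rfl fun v _ => by simp only [hT]]
  rw [sum_normSq_placeGate_castLE (copy_fits x.length) ((P.F.circ x.length).toMatrix 0) (padBlock P x)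
    (fun u : QReg (x.length + P.F.ancillas x.length) => u ⟨0, by omega⟩ = true ∧ u ⟨1, by omega⟩ = true),
    padBlock_comp_castLE, accW]
  refine Finset.sum_congr rfl fun u _ => ?_
  have h1 : 1 < x.length + P.F.ancillas x.length := by omega
  simp [h1]

/-- **The block weight of "reject and post-select" is `rejW`.** [cite: NielsenChuang2010, §2.2.8 (measurement of one register of a product state)] -/
theorem sum_blockState_rejB (h2 : 2 ≤ x.length + P.F.ancillas x.length) :
    (∑ v : QReg (b P x.length), if rejB v then ‖blockState P x v‖ ^ 2 else 0) = rejW P x := by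
  classical
  have hT : ∀ v : QReg (b P x.length), rejB v ↔
      ((v ∘ Fin.castLEEmb (copy_fits x.length)) ⟨0, by omega⟩ = false ∧ (v ∘ Fin.castLEEmb (copy_fits x.length)) ⟨1, by omega⟩ = true) :=
    fun v => Iff.rfl
  simp only [blockState, Cpad, toMatrix_mapWires]
  rw [show (∑ v : QReg (b P x.length), if rejB v then ‖(placeGate (Fin.castLEEmb (copy_fits x.length)) ((P.F.circ x.length).toMatrix 0) *ᵥ
      basisState (padBlock P x)) v‖ ^ 2 else 0) = ∑ v : QReg (b P x.length),
      if ((v ∘ Fin.castLEEmb (copy_fits x.length)) ⟨0, by omega⟩ = false ∧ (v ∘ Fin.castLEEmb (copy_fits x.length)) ⟨1, by omega⟩ = true) then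
        ‖(placeGate (Fin.castLEEmb (copy_fits x.length)) ((P.F.circ x.length).toMatrix 0) *ᵥ basisState (padBlock P x)) v‖ ^ 2 else 0
    from Finset.sum_congr rfl fun v _ => by simp only [hT]]
  rw [sum_normSq_placeGate_castLE (copy_fits x.length) ((P.F.circ x.length).toMatrix 0) (padBlock P x)
    (fun u : QReg (x.length + P.F.ancillas x.length) => u ⟨0, by omega⟩ = false ∧ u ⟨1, by omega⟩ = true),
    padBlock_comp_castLE, rejW]
  refine Finset.sum_congr rfl fun u _ => ?_
  have h1 : 1 < x.length + P.F.ancillas x.length := by omega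
  simp [h1]

/-! ### Product weights -/

/-- **Born weights of the product state against a product event**: the `K`-th power of the
block weight. [cite: NielsenChuang2010, §2.2.8 (composite systems)] -/
theorem sum_normSq_prodState_prod (T : QReg (b P x.length) → Prop) [DecidablePred T] :
    (∑ z : QReg (x.length + anc P x.length), ‖prodState (blockEmb P x.length) (fun _ => blockState P x) (W1 P x) z‖ ^ 2 *
        ∏ j : Fin P.K, (if T (z ∘ blockEmb P x.length j) then (1 : ℝ) else 0)) =
      (∑ v : QReg (b P x.length), if T v then ‖blockState P x v‖ ^ 2 else 0) ^ P.K := by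
  rw [sum_normSq_prodState_mul blockDisjoint (fun _ => blockState P x) (W1 P x)
    (fun y => ∏ j : Fin P.K, (if T (y j) then (1 : ℝ) else 0)), Finset.sum_pow']
  simp only [Fintype.piFinset_univ]
  refine Finset.sum_congr rfl fun y _ => ?_
  rw [← Finset.prod_mul_distrib]
  refine Finset.prod_congr rfl fun j _ => ?_
  split_ifs <;> simp

/-! ### The measured events pulled back along stage 2 -/

/-- A label of the support: it agrees with `w1 x` off the blocks. [folklore] -/
def Agrees (z : QReg (x.length + anc P x.length)) : Prop := ∀ w, OffBlocks (blockEmb P x.length) w → z w = W1 P x w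

/-- On the support, the lifted label is `0` on the wires in `[|x|, base)`. [folklore] -/
theorem liftW_of_agrees {z : QReg (x.length + anc P x.length)} (hz : Agrees z) {p : ℕ} (hp : x.length ≤ p) (hp' : p < base P x.length) :
    liftW z p = false := by
  have hpN : p < x.length + anc P x.length := by rw [n_add_anc]; exact hp'.trans (base_lt_W _)
  have e : liftW z p = z ⟨p, hpN⟩ := liftW_val z ⟨p, hpN⟩
  rw [e, hz _ ((offBlocks_iff _).2 hp')]
  exact w1_of_le_of_lt_base x hp hp'

/-- On the support: the seed wire is `0`. [folklore] -/
theorem liftW_oneW {z : QReg (x.length + anc P x.length)} (hz : Agrees z) : liftW z (oneW P x.length) = false :=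
  liftW_of_agrees hz ((Nat.le_add_right _ 2).trans (add_two_le_b _)) (oneW_lt_base _)

/-- On the support: the `cP` ancillas are `0`. [folklore] -/
theorem liftW_cP {z : QReg (x.length + anc P x.length)} (hz : Agrees z) : ∀ t < P.K, liftW z (cP P x.length t) = false :=
  fun _ ht => liftW_of_agrees hz (((Nat.le_add_right _ 2).trans (add_two_le_b _)).trans (b_lt_cP _ _).le) (cP_lt_base ht)

/-- On the support: the `cA` ancillas are `0`. [folklore] -/
theorem liftW_cA {z : QReg (x.length + anc P x.length)} (hz : Agrees z) : ∀ t < P.K, liftW z (cA P x.length t) = false :=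
  fun _ ht => liftW_of_agrees hz (((Nat.le_add_right _ 2).trans (add_two_le_b _)).trans (b_lt_cA _ _).le) (cA_lt_base ht)

/-- On the support: the `cR` ancillas are `0`. [folklore] -/
theorem liftW_cR {z : QReg (x.length + anc P x.length)} (hz : Agrees z) : ∀ t < P.K, liftW z (cR P x.length t) = false :=
  fun _ ht => liftW_of_agrees hz (((Nat.le_add_right _ 2).trans (add_two_le_b _)).trans (b_lt_cR _ _).le) (cR_lt_base ht)

/-- `Aval` of a lifted label is the product event "every block accepts and post-selects". [folklore] -/
theorem Aval_liftW_iff (z : QReg (x.length + anc P x.length)) :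
    Aval P x.length (liftW z) = true ↔ ∀ j : Fin P.K, accB (z ∘ blockEmb P x.length j) := by
  rw [Aval_eq_true_iff]
  constructor
  · intro h j
    obtain ⟨h1, h0⟩ := h j j.isLt
    exact ⟨(liftW_val z (blockEmb P x.length j ⟨0, _⟩)).symm.trans h0, (liftW_val z (blockEmb P x.length j ⟨1, _⟩)).symm.trans h1⟩
  · intro h j hj
    obtain ⟨h0, h1⟩ := h ⟨j, hj⟩
    exact ⟨(liftW_val z (blockEmb P x.length ⟨j, hj⟩ ⟨1, _⟩)).trans h1, (liftW_val z (blockEmb P x.length ⟨j, hj⟩ ⟨0, _⟩)).trans h0⟩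

/-- `Rval` of a lifted label is the product event "every block rejects and post-selects". [folklore] -/
theorem Rval_liftW_iff (z : QReg (x.length + anc P x.length)) :
    Rval P x.length (liftW z) = true ↔ ∀ j : Fin P.K, rejB (z ∘ blockEmb P x.length j) := by
  rw [Rval_eq_true_iff]
  constructor
  · intro h j
    obtain ⟨h1, h0⟩ := h j j.isLt
    exact ⟨(liftW_val z (blockEmb P x.length j ⟨0, _⟩)).symm.trans h0, (liftW_val z (blockEmb P x.length j ⟨1, _⟩)).symm.trans h1⟩
  · intro h j hj
    obtain ⟨h0, h1⟩ := h ⟨j, hj⟩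
    exact ⟨(liftW_val z (blockEmb P x.length ⟨j, hj⟩ ⟨1, _⟩)).trans h1, (liftW_val z (blockEmb P x.length ⟨j, hj⟩ ⟨0, _⟩)).trans h0⟩

/-- The indicator of a conjunction over the blocks is the product of the indicators. [folklore] -/
theorem ite_forall_eq_prod (T : QReg (b P x.length) → Prop) [DecidablePred T] (y : Fin P.K → QReg (b P x.length)) :
    (if (∀ j, T (y j)) then (1 : ℝ) else 0) = ∏ j, (if T (y j) then (1 : ℝ) else 0) := by
  by_cases h : ∀ j, T (y j)
  · rw [if_pos h, Finset.prod_eq_one fun j _ => if_pos (h j)]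
  · push Not at h
    obtain ⟨j, hj⟩ := h
    rw [if_neg (fun h' => hj (h' j)), Finset.prod_eq_zero (Finset.mem_univ j) (if_neg hj)]

/-- There are two wires. [folklore] -/
theorem one_lt_width (n : ℕ) : 1 < n + anc P n := by
  rw [n_add_anc]; exact lt_of_lt_of_le (lt_of_lt_of_le Nat.one_lt_two (two_le_b n)) ((b_lt_base n).le.trans (base_le_W n))

/-- **The post-selection probability of the amplified family** is `accW^K + rejW^K`. [cite: BremnerJozsaShepherdPRSA2011, §2.4 p. 6 (multiple runs; single-line registers via a simple reversible function)] -/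
theorem postselectProbOn_family (h2 : 2 ≤ x.length + P.F.ancillas x.length) :
    (family P).postselectProbOn 0 x = accW P x ^ P.K + rejW P x ^ P.K := by
  classical
  have hK := one_lt_width (P := P) x.length
  -- the Born sum, pushed back along stage 2
  have hE : (family P).postselectProbOn 0 x = ∑ z : QReg (x.length + anc P x.length),
      if perm2 P x.length z ∈ QCircuit.postselectEvent (x.length + anc P x.length) then
        ‖prodState (blockEmb P x.length) (fun _ => blockState P x) (W1 P x) z‖ ^ 2 else 0 := by
    change (circ P x.length).postselectProb 0 x.get = _
    unfold QCircuit.postselectProb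
    rw [probEvent_eq_sum_ite, runOn_circ]
    exact sum_ite_normSq_mulVec_of_perm (perm2 P x.length) (toMatrix_stage2_mulVec_basisState 0) _ _
  rw [hE, ← sum_blockState_accB h2, ← sum_blockState_rejB h2, ← sum_normSq_prodState_prod, ← sum_normSq_prodState_prod,
    ← Finset.sum_add_distrib]
  refine Finset.sum_congr rfl fun z _ => ?_
  by_cases hz : Agrees z
  · -- on the support, wire `1` after stage 2 reads `R ⊕ A`
    have h1 : (perm2 P x.length z ∈ QCircuit.postselectEvent (x.length + anc P x.length)) ↔
        (Rval P x.length (liftW z) ^^ Aval P x.length (liftW z)) = true := by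
      rw [QCircuit.postselectEvent, Set.mem_setOf_eq]
      constructor
      · rintro ⟨h, hy⟩
        rw [perm2_apply] at hy
        exact (clEval_prog2_one (liftW_oneW hz) (liftW_cP hz) (liftW_cA hz) (liftW_cR hz)).symm.trans hy
      · intro h
        exact ⟨hK, (perm2_apply z ⟨1, hK⟩).trans ((clEval_prog2_one (liftW_oneW hz) (liftW_cP hz) (liftW_cA hz) (liftW_cR hz)).trans h)⟩
    rw [← mul_add, ← ite_forall_eq_prod, ← ite_forall_eq_prod]
    have hA := Aval_liftW_iff (P := P) z
    have hR := Rval_liftW_iff (P := P) z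
    have hAR := not_Aval_and_Rval (P := P) x.length (liftW z)
    by_cases hAv : Aval P x.length (liftW z) = true <;> by_cases hRv : Rval P x.length (liftW z) = true
    · exact absurd ⟨hAv, hRv⟩ hAR
    · rw [if_pos (h1.2 (by rw [hAv, Bool.eq_false_iff.2 hRv]; rfl)), if_pos (hA.1 hAv), if_neg (fun h => hRv (hR.2 h))]; ring
    · rw [if_pos (h1.2 (by rw [hRv, Bool.eq_false_iff.2 hAv]; rfl)), if_neg (fun h => hAv (hA.2 h)), if_pos (hR.1 hRv)]; ring
    · rw [if_neg (fun h => by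
        have := h1.1 h
        rw [Bool.eq_false_iff.2 hAv, Bool.eq_false_iff.2 hRv] at this
        exact Bool.noConfusion this), if_neg (fun h => hAv (hA.2 h)), if_neg (fun h => hRv (hR.2 h))]; ring
  · -- off the support the product state vanishes
    have h0 : prodState (blockEmb P x.length) (fun _ => blockState P x) (W1 P x) z = 0 := by
      have hz' : ¬ (∀ w, OffBlocks (blockEmb P x.length) w → z w = W1 P x w) := hz
      rw [prodState_apply, if_neg hz', zero_mul]
    simp [h0]

/-- **The joint acceptance probability of the amplified family** is `accW^K`. [cite: BremnerJozsaShepherdPRSA2011, §2.4 p. 6 (multiple runs; single-line registers via a simple reversible function)] -/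
theorem jointAcceptProbOn_family (h2 : 2 ≤ x.length + P.F.ancillas x.length) :
    (family P).jointAcceptProbOn 0 x = accW P x ^ P.K := by
  classical
  have hK := one_lt_width (P := P) x.length
  have hK0 : 0 < x.length + anc P x.length := by omega
  have hE : (family P).jointAcceptProbOn 0 x = ∑ z : QReg (x.length + anc P x.length),
      if perm2 P x.length z ∈ QCircuit.jointAcceptEvent (x.length + anc P x.length) then
        ‖prodState (blockEmb P x.length) (fun _ => blockState P x) (W1 P x) z‖ ^ 2 else 0 := by
    change (circ P x.length).jointAcceptProb 0 x.get = _
    unfold QCircuit.jointAcceptProb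
    rw [probEvent_eq_sum_ite, runOn_circ]
    exact sum_ite_normSq_mulVec_of_perm (perm2 P x.length) (toMatrix_stage2_mulVec_basisState 0) _ _
  rw [hE, ← sum_blockState_accB h2, ← sum_normSq_prodState_prod]
  refine Finset.sum_congr rfl fun z _ => ?_
  by_cases hz : Agrees z
  · have h1 : (perm2 P x.length z ∈ QCircuit.jointAcceptEvent (x.length + anc P x.length)) ↔
        (Aval P x.length (liftW z) = true ∧ (Rval P x.length (liftW z) ^^ Aval P x.length (liftW z)) = true) := by
      rw [QCircuit.jointAcceptEvent, Set.mem_setOf_eq]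
      have e0 := (perm2_apply z ⟨0, hK0⟩).trans (clEval_prog2_zero (liftW_oneW hz) (liftW_cP hz) (liftW_cA hz))
      have e1 := (perm2_apply z ⟨1, hK⟩).trans (clEval_prog2_one (liftW_oneW hz) (liftW_cP hz) (liftW_cA hz) (liftW_cR hz))
      constructor
      · rintro ⟨h, hy0, hy1⟩
        exact ⟨e0.symm.trans hy0, e1.symm.trans hy1⟩
      · rintro ⟨h0, h1⟩
        exact ⟨hK, e0.trans h0, e1.trans h1⟩
    rw [← ite_forall_eq_prod]
    have hA := Aval_liftW_iff (P := P) z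
    have hAR := not_Aval_and_Rval (P := P) x.length (liftW z)
    by_cases hAv : Aval P x.length (liftW z) = true
    · have hRv : Rval P x.length (liftW z) = false := Bool.eq_false_iff.2 fun h => hAR ⟨hAv, h⟩
      rw [if_pos (h1.2 ⟨hAv, by rw [hAv, hRv]; rfl⟩), if_pos (hA.1 hAv), mul_one]
    · rw [if_neg (fun h => hAv (h1.1 h).1), if_neg (fun h => hAv (hA.2 h)), mul_zero]
  · have h0 : prodState (blockEmb P x.length) (fun _ => blockState P x) (W1 P x) z = 0 := by
      have hz' : ¬ (∀ w, OffBlocks (blockEmb P x.length) w → z w = W1 P x w) := hz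
      rw [prodState_apply, if_neg hz', zero_mul]
    simp [h0]

end Weights

/-! ## Part IV. The amplified family is uniform

By `QCircuitFamily.isUniform_of_descFn_mem_FP` it suffices that the description
`1ⁿ ↦ ⟨bin n, ⟨1^{anc n}, encode (circ n)⟩⟩` is in `FP`; `encode (circ n)` is the concatenation
(`RevDesc.encode_eq_flatMap`) of the description bits of stage 1 (a generator program with two
nested loops, `gen1`), of the `K` pieces "swap (generator `RevMuxGen.swapsG`), the description of
`F.circ n` verbatim (the body of `F.descFn ∈ FP`), swap", and of stage 2 (a loop-free generator,
`opsG prog2E`), all rendered in polynomial time by `GStmt.render_out_mem_FP`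
(Arora–Barak 2009, §6.2 and proof of Thm. 6.15: descriptions written with counters). -/

section Uniform

open Polynomial RevDesc Complexity.Brick Plumb

/-! ### Stage descriptions are program descriptions -/

variable {P}

/-- The description bits of a clamped compiled program are the `opBits` of the program.
[cite: AroraBarak2009, §6.1 (descriptions of circuits)] -/
theorem flatMap_gateEnc_clamp (n : ℕ) (ops : List (ClOp ℕ)) (hlt : ∀ op ∈ ops, ∀ i ∈ wiresOf op, i < n + anc P n)
    (hwf : ∀ op ∈ ops, op.WF) :
    (revCompile (clamp P n ops hlt hwf)).flatMap gateEnc = ops.flatMap opBits :=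
  flatMap_gateEnc_revCompile_toRevList (width_pos n) ops hlt _

/-- Stage 1 describes as `prog1`. [folklore] -/
theorem flatMap_gateEnc_stage1 (n : ℕ) : (stage1 P n).flatMap gateEnc = (prog1 P n).flatMap opBits :=
  flatMap_gateEnc_clamp n _ _ _

/-- Stage 2 describes as `prog2`. [folklore] -/
theorem flatMap_gateEnc_stage2 (n : ℕ) : (stage2 P n).flatMap gateEnc = (prog2 P n).flatMap opBits :=
  flatMap_gateEnc_clamp n _ _ _

/-- The conjugating swap describes as `progConj` (for `j < K`). [folklore] -/
theorem flatMap_gateEnc_conjGates {n j : ℕ} (hj : j < P.K) :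
    (conjGates P n j).flatMap gateEnc = (progConj P n j).flatMap opBits := by
  unfold conjGates; rw [dif_pos hj]; exact flatMap_gateEnc_clamp n _ _ _

/-- The copy describes as the given circuit, verbatim. [cite: AroraBarak2009, §6.2 (a circuit for each input length, hard-wired)] -/
theorem flatMap_gateEnc_copyGates (n : ℕ) : (copyGates P n).flatMap gateEnc = (P.F.circ n).encode := by
  unfold copyGates
  rw [show (P.F.circ n).encode = QCircuit.encode (⟨(P.F.circ n).gates⟩ : QCircuit cliffordT _) from rfl, encode_eq_flatMap]
  simp only [mapWires, List.flatMap_map, CWrap.gateEnc_mapWiresGate_castLEEmb]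

/-! ### The layout as counter expressions -/

variable (P)

/-- The block width `b` as an expression in the input length `uu`. [folklore] -/
def bE : GE := .add (.add (.var .uu) (CWrap.polyE P.pF (.var .uu))) (.const 2)

/-- The first block wire `base` as an expression. [folklore] -/
def baseE : GE := .add (.add (bE P) (.const 1)) (.const (3 * P.K))

/-- Wire `i` of block `j` as an expression transformer. [folklore] -/
def blkE (jE iE : GE) : GE := .add (.add (baseE P) (.mul jE (bE P))) iE

/-- Chain ancilla `cP t` as an expression. [folklore] -/
def cPE (t : ℕ) : GE := .add (.add (bE P) (.const 1)) (.const t)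

/-- Chain ancilla `cA t` as an expression. [folklore] -/
def cAE (t : ℕ) : GE := .add (.add (.add (bE P) (.const 1)) (.const P.K)) (.const t)

/-- Chain ancilla `cR t` as an expression. [folklore] -/
def cRE (t : ℕ) : GE := .add (.add (.add (bE P) (.const 1)) (.const (2 * P.K))) (.const t)

variable {P}

/-- Value of `bE`. [folklore] -/
@[simp] theorem eval_bE (env : GV → ℕ) : (bE P).eval env = b P (env .uu) := by
  simp [bE, GExpr.eval, b]

/-- Value of `baseE`. [folklore] -/
@[simp] theorem eval_baseE (env : GV → ℕ) : (baseE P).eval env = base P (env .uu) := by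
  simp [baseE, GExpr.eval, base]

/-- Value of `blkE`. [folklore] -/
@[simp] theorem eval_blkE (jE iE : GE) (env : GV → ℕ) : (blkE P jE iE).eval env = blk P (env .uu) (jE.eval env) (iE.eval env) := by
  simp [blkE, GExpr.eval, blk]

/-- Value of `cPE`. [folklore] -/
@[simp] theorem eval_cPE (t : ℕ) (env : GV → ℕ) : (cPE P t).eval env = cP P (env .uu) t := by
  simp [cPE, GExpr.eval, cP]

/-- Value of `cAE`. [folklore] -/
@[simp] theorem eval_cAE (t : ℕ) (env : GV → ℕ) : (cAE P t).eval env = cA P (env .uu) t := by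
  simp [cAE, GExpr.eval, cA]

/-- Value of `cRE`. [folklore] -/
@[simp] theorem eval_cRE (t : ℕ) (env : GV → ℕ) : (cRE P t).eval env = cR P (env .uu) t := by
  simp [cRE, GExpr.eval, cR]

/-! ### Stage 1: a generator with two nested loops -/

variable (P)

/-- **Generator of stage 1**: `for j < K, for i < n: CNOT i (blk j i)`. [cite: AroraBarak2009, §6.2 (descriptions printed with counters)] -/
def gen1 : GS :=
  GStmt.loop .jj (.const P.K) (GStmt.loop .tt (.var .uu) (opsG [ClOp.cnot (.var .tt) (blkE P (.var .jj) (.var .tt))]))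

variable {P}

/-- **The stage-1 generator prints `prog1`.** [folklore] -/
theorem out_gen1 (env : GV → ℕ) : (gen1 P).out env = (prog1 P (env .uu)).flatMap opToks := by
  have hut : ∀ k k', Function.update (Function.update env GV.jj k) GV.tt k' GV.uu = env GV.uu := fun k k' => by
    rw [Function.update_of_ne (by decide), Function.update_of_ne (by decide)]
  have hutj : ∀ k k', Function.update (Function.update env GV.jj k) GV.tt k' GV.jj = k := fun k k' => by
    rw [Function.update_of_ne (by decide), Function.update_self]
  have huj : ∀ k, Function.update env GV.jj k GV.uu = env GV.uu := fun k => Function.update_of_ne (by decide) _ _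
  simp only [gen1, GStmt.out, out_opsG, List.map_cons, List.map_nil, ClOp.map, GExpr.eval, Function.update_self, hut, hutj,
    huj, eval_blkE, List.flatMap_cons, List.flatMap_nil, List.append_nil, prog1, List.flatMap_assoc, List.flatMap_map]

/-- `uu` is not a loop variable of the stage-1 generator. [folklore] -/
theorem uu_notMem_loopVars_gen1 : GV.uu ∉ (gen1 P).loopVars := by
  intro h
  simp only [gen1, GStmt.loopVars, List.mem_cons] at h
  rcases h with h | h | h
  · exact absurd h (by decide)
  · exact absurd h (by decide)
  · exact absurd (loopVars_opsG_sub _ _ h) (by decide)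

/-- Non-reuse of the stage-1 generator. [folklore] -/
theorem noReuse_gen1 : (gen1 P).noReuse = true :=
  noReuse_loop_of (lv_loop (P := (· ≠ GV.jj)) (by decide) (lv_opsG (by decide) _))
    (noReuse_loop_of (lv_opsG (by decide) _) (noReuse_opsG _))

/-- **Stage 1 describes in polynomial time.** [cite: AroraBarak2009, §6.2 Def. 6.12 and Remark 6.7 (descriptions printed in polynomial time)] -/
theorem stage1_desc_mem_FP : (fun z : List Bool => (stage1 P z.length).flatMap gateEnc) ∈ FP := by
  have h := GStmt.render_out_mem_FP (gen1 P) GV.uu uu_notMem_loopVars_gen1 noReuse_gen1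
  refine (congrArg (· ∈ FP) (funext fun z => ?_)).mpr h
  rw [out_gen1, RevClean.render_flatMap_opToks_nil, GenProg.initEnv_self, flatMap_gateEnc_stage1]

/-! ### The conjugating swaps: the swap generator -/

/-- **The swap generator prints `progConj n j`.** [folklore] -/
theorem out_swapsG_conj (j : ℕ) (env : GV → ℕ) :
    (RevMuxGen.swapsG (fun c => c) (fun c => blkE P (.const j) c) (bE P)).out env = (progConj P (env .uu) j).flatMap opToks := by
  rw [RevMuxGen.out_swapsG (a := fun _ i => i) (b := fun u i => blk P u j i) (fun c env => rfl) (fun c env => by simp [GExpr.eval]),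
    eval_bE, progConj, conjPairs, swapOps, List.flatMap_map]

/-- **The conjugating swap describes in polynomial time.** [cite: AroraBarak2009, §6.2 Def. 6.12 and Remark 6.7 (descriptions printed in polynomial time)] -/
theorem conj_desc_mem_FP {j : ℕ} (hj : j < P.K) : (fun z : List Bool => (conjGates P z.length j).flatMap gateEnc) ∈ FP := by
  have hx : GV.uu ∉ (RevMuxGen.swapsG (fun c => c) (fun c => blkE P (.const j) c) (bE P)).loopVars := fun h => by
    rcases RevMuxGen.loopVars_swapsG _ _ _ _ h with h | h <;> exact absurd h (by decide)
  have h := GStmt.render_out_mem_FP _ GV.uu hx (RevMuxGen.noReuse_swapsG _ _ _)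
  refine (congrArg (· ∈ FP) (funext fun z => ?_)).mpr h
  rw [out_swapsG_conj, RevClean.render_flatMap_opToks_nil, GenProg.initEnv_self, flatMap_gateEnc_conjGates hj]

/-! ### The copy: the body of the given description -/

/-- **The copy describes in polynomial time** (for a uniform given family). [cite: AroraBarak2009, §6.2 (P-uniform circuit families)] -/
theorem copy_desc_mem_FP (hU : P.F.IsUniform) : (fun z : List Bool => (copyGates P z.length).flatMap gateEnc) ∈ FP := by
  have h := comp_mem_FP sndF_mem_FP (comp_mem_FP sndF_mem_FP (QCircuitFamily.descFn_mem_FP_of_isUniform hU))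
  refine (congrArg (· ∈ FP) (funext fun z => ?_)).mpr h
  simp only [Function.comp_apply, CWrap.sndF_sndF_descFn, flatMap_gateEnc_copyGates]

/-! ### The quantum stage -/

/-- A `flatMap` of `FP` functions over a fixed list is in `FP`. [folklore] -/
theorem flatMap_mem_FP {ι : Type*} (l : List ι) (f : ι → List Bool → List Bool) (hf : ∀ i ∈ l, f i ∈ FP) :
    (fun z => l.flatMap fun i => f i z) ∈ FP := by
  induction l with
  | nil => exact const_mem_FP []
  | cons a l ih =>
    have h := append_mem_FP (hf a (by simp)) (ih fun i hi => hf i (by simp [hi]))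
    refine (congrArg (· ∈ FP) (funext fun z => ?_)).mpr h
    rw [List.flatMap_cons]

/-- **The quantum stage describes in polynomial time.** [cite: AroraBarak2009, §6.2 Def. 6.12 and Remark 6.7 (descriptions printed in polynomial time)] -/
theorem stageQ_desc_mem_FP (hU : P.F.IsUniform) : (fun z : List Bool => (stageQ P z.length).flatMap gateEnc) ∈ FP := by
  have h := flatMap_mem_FP (List.range P.K)
    (fun j z => (conjGates P z.length j).flatMap gateEnc ++ ((copyGates P z.length).flatMap gateEnc ++ (conjGates P z.length j).flatMap gateEnc))
    (fun j hj => append_mem_FP (conj_desc_mem_FP (List.mem_range.1 hj))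
      (append_mem_FP (copy_desc_mem_FP hU) (conj_desc_mem_FP (List.mem_range.1 hj))))
  refine (congrArg (· ∈ FP) (funext fun z => ?_)).mpr h
  simp only [stageQ, List.flatMap_assoc, List.flatMap_append]

/-! ### Stage 2: a loop-free generator -/

variable (P)

/-- The post-selection wires as expressions. [folklore] -/
def postsE : List GE := (List.range P.K).map fun j => blkE P (.const j) (.const 1)

/-- The output wires as expressions. [folklore] -/
def outsE : List GE := (List.range P.K).map fun j => blkE P (.const j) (.const 0)

/-- **Stage 2 with expression wires** (mirrors `prog2`). [cite: AroraBarak2009, §6.2 (descriptions printed with counters)] -/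
def prog2E : List (ClOp GE) :=
  [ClOp.not (bE P)] ++ clChain (bE P) (postsE P) ((List.range P.K).map (cPE P)) ++
    clChain (cPE P (P.K - 1)) (outsE P) ((List.range P.K).map (cAE P)) ++ (outsE P).map ClOp.not ++
      clChain (cPE P (P.K - 1)) (outsE P) ((List.range P.K).map (cRE P)) ++ [ClOp.cnot (cAE P (P.K - 1)) (cRE P (P.K - 1))] ++
        swapOps [(cAE P (P.K - 1), .const 0), (cRE P (P.K - 1), .const 1)]

variable {P}

/-- Re-indexing a swap layer. [folklore] -/
theorem map_swapOps {α β : Type} (f : α → β) (ps : List (α × α)) :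
    (swapOps ps).map (ClOp.map f) = swapOps (ps.map (Prod.map f f)) := by
  induction ps with
  | nil => rfl
  | cons p ps ih => rw [List.map_cons, swapOps_cons, swapOps_cons, List.map_append, ih]; rfl

/-- **The stage-2 expression program evaluates to `prog2`.** [folklore] -/
theorem prog2E_map (env : GV → ℕ) : (prog2E P).map (ClOp.map (GExpr.eval env)) = prog2 P (env .uu) := by
  simp only [prog2E, prog2, List.map_append, List.map_cons, List.map_nil, map_clChain, map_swapOps, List.map_map, ClOp.map,
    Prod.map, eval_bE, eval_cPE, eval_cAE, eval_cRE, GExpr.eval, postsE, outsE, posts, outs, cPs, cAs, cRs, oneW, aP, aA, aR,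
    Function.comp_def, eval_blkE]

/-- **Stage 2 describes in polynomial time.** [cite: AroraBarak2009, §6.2 Def. 6.12 and Remark 6.7 (descriptions printed in polynomial time)] -/
theorem stage2_desc_mem_FP : (fun z : List Bool => (stage2 P z.length).flatMap gateEnc) ∈ FP := by
  have hx : GV.uu ∉ (opsG (prog2E P)).loopVars := fun h => absurd (loopVars_opsG_sub _ _ h) (by decide)
  have h := GStmt.render_out_mem_FP (opsG (prog2E P)) GV.uu hx (noReuse_opsG _)
  refine (congrArg (· ∈ FP) (funext fun z => ?_)).mpr h
  rw [out_opsG, prog2E_map, RevClean.render_flatMap_opToks_nil, GenProg.initEnv_self, flatMap_gateEnc_stage2]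

/-! ### The header and the assembly -/

variable (P)

/-- `W(n)` as a polynomial: `(K+1)·b + 1 + 3K`. [folklore] -/
def WPoly : Polynomial ℕ := (C P.K + 1) * (X + P.pF + C 2) + C (1 + 3 * P.K)

/-- Value of `WPoly`. [folklore] -/
@[simp] theorem eval_WPoly (n : ℕ) : (WPoly P).eval n = W P n := by
  simp [WPoly, W, base, b]; ring

/-- The ancilla count in unary: `1^{W n}` with the first `n` symbols dropped. [folklore] -/
def ancF : List Bool → List Bool := dropFn ∘ fanoutFn (fun z => z) (polyFn (WPoly P))

/-- Value of `ancF`. [folklore] -/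
theorem ancF_apply (z : List Bool) : ancF P z = unaryEncodeNat (anc P z.length) := by
  simp only [ancF, Function.comp_apply, fanoutFn_apply, dropFn_boolPair, polyFn_apply, eval_WPoly, ones, List.drop_replicate, anc]
  exact (RevDesc.unaryEncodeNat_eq_replicate _).symm

/-- `ancF ∈ FP`. [folklore] -/
theorem ancF_mem_FP : ancF P ∈ FP := comp_mem_FP dropFn_mem_FP (fanoutFn_mem_FP (PolyTimeComputable.id _) (polyFn_mem_FP _))

/-- **The amplified family is polynomial-time uniform** (if the given family is). [cite: AroraBarak2009, §6.2 Def. 6.12 and Remark 6.7 (descriptions printed in polynomial time)] -/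
theorem family_isUniform (hU : P.F.IsUniform) : (family P).IsUniform := by
  refine QCircuitFamily.isUniform_of_descFn_mem_FP ?_
  have h := fanoutFn_mem_FP lenBinF_mem_FP (fanoutFn_mem_FP (ancF_mem_FP P)
    (append_mem_FP (stage1_desc_mem_FP (P := P)) (append_mem_FP (stageQ_desc_mem_FP hU) (stage2_desc_mem_FP (P := P)))))
  have e : (family P).descFn = fanoutFn lenBinF (fanoutFn (ancF P)
      (fun z => (stage1 P z.length).flatMap gateEnc ++ ((stageQ P z.length).flatMap gateEnc ++ (stage2 P z.length).flatMap gateEnc))) := by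
    funext z
    have henc : (circ P z.length).encode = (stage1 P z.length ++ (stageQ P z.length ++ stage2 P z.length)).flatMap gateEnc := by
      unfold circ; exact encode_eq_flatMap _
    rw [fanoutFn_apply, fanoutFn_apply, lenBinF_apply, ancF_apply, QCircuitFamily.descFn_eq]
    dsimp only [family_circ, family_ancillas]
    rw [henc, List.flatMap_append, List.flatMap_append]
  rw [e]
  exact h

end Uniform

/-! ## Summary: the amplified family -/

/-- **The amplified family of a uniform oracle-free family**: for every `K ≥ 1` there is a uniform
oracle-free Clifford+T family whose post-selection weight on every input `x` (with at least two
wires in the given circuit) is `a^K + r^K` and whose joint acceptance weight is `a^K`, where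
`a = Pr[out = 1 ∧ post = 1]` and `a + r = Pr[post = 1]` are the weights of the given family on
`x`. [cite: BremnerJozsaShepherdPRSA2011, §2.4 p. 6 (post-BQP is independent of the error tolerance)] -/
theorem exists_amplified {F : QCircuitFamily cliffordT} (hF : F.IsOracleFree) (hU : F.IsUniform) {K : ℕ} (hK : 0 < K) :
    ∃ F' : QCircuitFamily cliffordT, F'.IsOracleFree ∧ F'.IsUniform ∧
      ∀ x : List Bool, 2 ≤ x.length + F.ancillas x.length →
        ∃ r : ℝ, 0 ≤ r ∧ F.jointAcceptProbOn 0 x + r = F.postselectProbOn 0 x ∧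
          F'.postselectProbOn 0 x = F.jointAcceptProbOn 0 x ^ K + r ^ K ∧ F'.jointAcceptProbOn 0 x = F.jointAcceptProbOn 0 x ^ K := by
  obtain ⟨pF, hpF⟩ := QCircuitFamily.IsUniform.isPolySize' hU
  let P : Params := ⟨F, pF, fun n => (hpF n).2, K, hK⟩
  refine ⟨family P, family_isOracleFree P hF, family_isUniform P hU, fun x h2 => ⟨rejW P x, rejW_nonneg, ?_, ?_, ?_⟩⟩
  · have e : accW P x = F.jointAcceptProbOn 0 x := accW_eq
    rw [← e]; exact accW_add_rejW
  · have e : accW P x = F.jointAcceptProbOn 0 x := accW_eq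
    rw [← e]; exact postselectProbOn_family h2
  · have e : accW P x = F.jointAcceptProbOn 0 x := accW_eq
    rw [← e]; exact jointAcceptProbOn_family h2

end PostBQPAmp

end Literature.Computability.QuantumComplexity

end
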